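import Literature.NumberTheory.GaloisRepresentations.ContinuousCohomologyNineTerm
import Literature.NumberTheory.GaloisCohomology.PoitouTateRealPlacesHigherDegree
import Literature.NumberTheory.GaloisRepresentations.PPrimaryDevissage
import Literature.NumberTheory.GaloisRepresentations.ConjugationDescent
import Literature.NumberTheory.GaloisRepresentations.GaloisCohomologyCorestriction
import Literature.NumberTheory.GaloisRepresentations.RestrictionOpenSubgroupIndex
import Literature.NumberTheory.GaloisRepresentations.AbsGaloisRestrictRealPlace
import Literature.NumberTheory.GaloisRepresentations.AbsGaloisInvolutionsRealPlacePerm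
import Literature.NumberTheory.GaloisCohomology.ArchimedeanInvariantMap
import Literature.NumberTheory.GaloisRepresentations.NumberFieldCdTwoProofs
import Literature.NumberTheory.GaloisRepresentations.GaloisSubgroups
import Literature.NumberTheory.GaloisRepresentations.InducedGaloisRep
import Mathlib.GroupTheory.Sylow
import Literature.NumberTheory.GaloisRepresentations.KummerSES
import Literature.NumberTheory.EllipticCurves.TwoDescentTwoTorsionCharacter
import Literature.NumberTheory.GaloisCohomology.BrauerClassLocalVanishing
import Literature.NumberTheory.GaloisCohomology.PoitouTatePrimePowerRealVanishing
import Literature.NumberTheory.GaloisCohomology.PoitouTateTwoRealPlacesSurjectiveHolds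
import Literature.NumberTheory.GaloisRepresentations.CyclicClassLevelChange
import Literature.NumberTheory.GaloisRepresentations.IdeleClassBarBoundaryPairing
import Literature.NumberTheory.GaloisRepresentations.IdeleClassBarInvariantSubgroup
import Literature.NumberTheory.GaloisRepresentations.GalLayerSystemSESLayers
import Literature.NumberTheory.GaloisRepresentations.GalLayerSystemColimit
import Literature.NumberTheory.GaloisRepresentations.GalLayerSystemUnitsBar
import Literature.NumberTheory.GaloisRepresentations.IdeleCohomologyLimit
import Literature.NumberTheory.GaloisRepresentations.IdeleClassH2Sequence
import Literature.NumberTheory.NumberFields.CyclicCyclotomicExtensionExists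
import Literature.Algebra.Homology.DiscreteRepGaloisCorollaries
import HarnessLib

/-!
# Poitou–Tate duality for finite modules, 2/7: `H³(K, M) → ⊕_{v real} H³(K_v, M)` is injective — `poitouTate_three_realPlaces_injective` HOLDS (re-homed proofs)

**Poitou–Tate duality for finite Galois modules over number fields and its consequences, proved in the tree's vocabulary from the idèle
class formation (Milne, *Arithmetic Duality Theorems* I §2, §4; Tate, ICM 1962; Harari 2020 Ch. 17–18; Serre, Durham 1977 §6): the named facts
`Literature.NumberTheory.GaloisCohomology.poitouTate_sha_tateDual` (PT (ii): `Ш¹(K, M)` and `Ш¹(K, M^D)` are exact annihilators, `PoitouTateSha.lean`),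
`…poitouTate_sha_zmod_mu` (its `ℤ/m` / `μ_m` instance), `…poitouTate_three_realPlaces_injective` (Milne I Thm. 4.10 (c), degree 3,
`PoitouTateRealPlacesHigherDegree.lean`), `…poitouTate_selmerStructure_duality_conj` (duality for Selmer structures with conjugation-compatible
canonical invariants, `PoitouTateSelmerStructuresConj.lean`), `Literature.NumberTheory.GaloisRepresentations.Patrikis2019_exists_lift_projective` / `…_exists_spinLift` /
`…_exists_spinLift_of_continuous` (Tate's `H²(Γ_K, ℚ/ℤ) = 0` and Patrikis' lifting statements, `ProjectiveLifting.lean`, `TateSpinLift.lean`,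
`TateSpinLiftContinuous.lean`) and `Literature.NumberTheory.GaloisCohomology.Howard2004.prop141_casselsTate_skewPairing_atLevel_printIntended` /
`…thm161_dvrKolyvaginBound_printIntended` (Howard 2004 Prop. 1.4.1 / Thm. 1.6.1 as intended, `Howard2004/`) HOLD — EXACT names `<fact>_holds`
(files 2 and 7 of 7).**  Contents: (1, definitions file) annihilators under a perfect `ℤ/n`-valued pairing of finite abelian groups and their counting
(Milne I §0), descent of `2`-cocycles through an open normal subgroup, the trivial module `ℤ/m` versus `μ_m` (transport maps); (2) `Ш³` and
`H³(K, M) → ⊕_{v real}` injectivity via the Brauer group (`H³(Γ_K, K̄ˣ) = 0`, odd descent, Sylow fields); (3) unramified local conditions,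
inertia and the unramified subgroup, local Tate pairing vanishing on unramified classes, exact orthogonality at almost all places, bidual transport,
the all-places reduction, presentation read-out and the reciprocity equality; (4) finiteness of Selmer groups, finite duality of `Ш`-duals, new places,
`Ш²` read-out roads, weak Leopoldt; (5) the real-place corrections, native `Ш²` assembly, presentation pairings, the idèle package and the reciprocity
sum; (6) local duality at every place, the Selmer-complement reduction, unramified orthogonality at all levels, the all-places reduction, the
middle-exact dual symmetry; (7) `Ш¹`-duality `poitouTate_sha_tateDual_holds`, the `ℤ/m`–`μ_m` instance, `H²`-finite support, Tate's theorem
`H²(Γ_K, ℚ/ℤ) = 0` for every number field and the Patrikis / Howard / Selmer-structure discharges.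
RE-HOMED into `Literature/` by the Hodge foundations lane (`lit-hodgefound`, seat p20, generation 40): verbatim DECLARATION-LEVEL ports (the 221
declarations needed, in dependency order; each Part is a slice of one Summits module) of 63 modules
`Summits/BirchSwinnertonDyer/BirchSwinnertonDyer/Theorems/{SchneiderFreeAdditiveX3PoitouTate*,SchneiderFreeAdditiveX3TateH2VanishingAllNumberFields,
CumulativeHeegnerLeopoldtRedSplitControlAtThreeSha*,ThetaPartnerAtTwoSignedControlAtTwo{MuReal*,ShaTwo*,ShaThree*,GlobalHTwoFiniteSupport},
KolyvaginRoadThreePTDevissageCofinite,PoitouTateSelmerStructureDualityConjHolds,Howard{Thm161PrintIntendedOfProp141Intended,FlachSkewPairingAtLevelIntendedHolds}}.lean`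
and `Summits/BirchSwinnertonDyer/Rank1Residual/{X11b,GaloisImage}/*.lean`; the namespaces `Summit.BirchSwinnertonDyer.BirchSwinnertonDyer.Theorems[.SchneiderFreeAdditiveX3]`
and `Summit.BirchSwinnertonDyer.Rank1Residual` are re-rooted at `Literature.NumberTheory.GaloisCohomology.PoitouTateFinite` (sub-namespaces `PoitouTateReduction`,
`PoitouTateShaTwoReadout`, `PoitouTateShaAnnihilator`, `SignedEC.*`, `KolyvaginRoadThreePT`, `InputsPoitouTateSelmer`, `Howard*`, `GaloisImage.*`, `X11b.*` kept);
four lemmas of `X11b/MaxUnramifiedRestriction.lean` already in `Literature/NumberTheory/GaloisRepresentations/UnramifiedClassesInertia.lean` are used from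
there; the nine `_holds` theorems carry the EXACT names.  Built on the tree's Literature layer (`Literature/NumberTheory/{GaloisRepresentations,GaloisCohomology,
Automorphic,EllipticCurves}/…`, `Literature/Algebra/Homology/…`, `Literature/AnabelianGeometry/AbsoluteAnabelian/…`).  No new named fact (D-0026); imports
Mathlib/Literature only; every declaration carries the citation of the printed statement it formalises or serves.  The Summits originals stay in
place (transitional duplication).  WHAT THIS IS NOT: nothing here bears on the Birch–Swinnerton-Dyer conjecture or any summit statement; it is
classical Poitou–Tate duality for finite modules (1960s) re-proved in the tree's vocabulary.
-/

noncomputable section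

/-!
## Part 1 — port of `Summits/BirchSwinnertonDyer/BirchSwinnertonDyer/Theorems/ThetaPartnerAtTwoSignedControlAtTwoShaThreeExtension.lean` (3 declarations kept)

# Poitou–Tate in degree `3` at the real places is INHERITED BY EXTENSIONS of Galois modules (dévissage step for Milne I Thm. 4.10 (c), `r = 3`; K4 `SignedControlAtTwo` stub 3 `stub_poitouTateThreeRealRat`)

Declarations of this Part (verbatim port; each keeps its own docstring and citation): `cohomologyMap_threeCocycleClass`, `pullback₃_id_resIdHom_apply`, `eq_zero_of_forall_localization_inl_three`.

Reference keys (see `references.bib` and the declarations' citations): [MilneADT2006], [SerreGaloisCohomology1997], [Harari2020].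
-/

section Part1

set_option autoImplicit false
open _root_.CategoryTheory _root_.NumberField _root_.Field _root_.Function
open _root_.TopRep _root_.ContRepresentation _root_.ContinuousCohomology
open Literature.NumberTheory.GaloisRepresentations
open Literature.NumberTheory.GaloisCohomology

universe u v

namespace Literature.NumberTheory.GaloisCohomology.PoitouTateFinite.SignedEC.ShaThree

/-! ## §0 `H³(f)` on explicit `3`-cocycles -/

section HelpersThree

variable {k : Type u} [CommRing k] [TopologicalSpace k]
variable {G : Type v} [Group G] [TopologicalSpace G] [IsTopologicalGroup G] [LocallyCompactSpace G]

/-- `H³(f) [c] = [f ∘ c]` on inhomogeneous continuous `3`-cocycles (degree-`3` twin of the tree's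
`cohomologyMap_twoCocycleClass`). [cite: SerreGaloisCohomology1997, I §2.2] -/
theorem cohomologyMap_threeCocycleClass {A B : TopRep.{v} k G} (f : A ⟶ B) (c : contThreeCocycles A) :
    cohomologyMap f 3 (threeCocycleClass A c) =
      threeCocycleClass B (contThreeCocycles.pullback (ContinuousMonoidHom.id G) (resIdHom f) c) :=
  map_threeCocycleClass _ _ _ c

omit [IsTopologicalGroup G] [LocallyCompactSpace G] in
/-- `(f ∘ c)(σ, τ, υ) = f (c(σ, τ, υ))` for the pulled-back `3`-cocycle along the identity. [cite: SerreGaloisCohomology1997, I §2.2] -/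
@[simp] theorem pullback₃_id_resIdHom_apply {A B : TopRep.{v} k G} (f : A ⟶ B)
    (c : contThreeCocycles A) (σ τ υ : G) :
    (contThreeCocycles.pullback (ContinuousMonoidHom.id G) (resIdHom f) c).1 (σ, τ, υ) =
      f.hom (c.1 (σ, τ, υ)) := rfl

end HelpersThree

/-! ## §1 The extension step, cochain-level -/

section Extension

variable {K : Type} [Field K] [NumberField K]
variable {M₁ M₂ M₃ : Type} [AddCommGroup M₁] [TopologicalSpace M₁] [DiscreteTopology M₁]
  [AddCommGroup M₂] [TopologicalSpace M₂] [DiscreteTopology M₂]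
  [AddCommGroup M₃] [TopologicalSpace M₃] [DiscreteTopology M₃]
variable {ρ₁ : DiscreteGaloisModule K M₁} {ρ₂ : DiscreteGaloisModule K M₂} {ρ₃ : DiscreteGaloisModule K M₃}
variable {f : ρ₁.toTopRep ⟶ ρ₂.toTopRep} {g : ρ₂.toTopRep ⟶ ρ₃.toTopRep}

/-- **Milne I Thm. 4.10 (c)₃ is inherited by extensions.**  Let `0 → M₁ →ᶠ M₂ →ᵍ M₃ → 0` be a short exact
sequence of discrete `Γ_K`-modules over a number field `K`.  If every class of `H³(K, M₁)` (resp. `H³(K, M₃)`)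
vanishing at all real places is zero, and every family of classes in `H²(K_w, M₃)` at the infinite places is,
at the real places, the localisation of one class of `H²(K, M₃)` (Milne I Cor. 4.16 at `M₃`), then every class
of `H³(K, M₂)` vanishing at all real places is zero.
[cite: MilneADT2006, Ch. I, Thm. 4.10 (c) and Cor. 4.16] [cite: SerreGaloisCohomology1997, I §2.2] -/
theorem IsSES.eq_zero_of_forall_localization_inl_three (h : IsSES f g)
    (h1 : ∀ a : galoisCohomology ρ₁ 3,
      (∀ w : InfinitePlace K, w.IsReal → galoisCohomology.localization ρ₁ (Sum.inl w) 3 a = 0) → a = 0)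
    (h3 : ∀ y : galoisCohomology ρ₃ 3,
      (∀ w : InfinitePlace K, w.IsReal → galoisCohomology.localization ρ₃ (Sum.inl w) 3 y = 0) → y = 0)
    (h2 : ∀ r : (∀ w : InfinitePlace K, galoisCohomology (ρ₃.toLocal (Sum.inl w)) 2),
      ∃ c : galoisCohomology ρ₃ 2,
        ∀ w : InfinitePlace K, w.IsReal → galoisCohomology.localization ρ₃ (Sum.inl w) 2 c = r w)
    (x : galoisCohomology ρ₂ 3)
    (hx : ∀ w : InfinitePlace K, w.IsReal → galoisCohomology.localization ρ₂ (Sum.inl w) 3 x = 0) :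
    x = 0 := by
  classical
  haveI : CompactSpace (absoluteGaloisGroup K) := absoluteGaloisGroup_compactSpace K
  haveI : ∀ w : InfinitePlace K, CompactSpace (absoluteGaloisGroup (Place.Completion (Sum.inl w : Place K))) :=
    fun w => absoluteGaloisGroup_compactSpace _
  -- localisation on explicit cocycles (degrees 2 and 3)
  have loc₂ : ∀ {N : Type} [AddCommGroup N] [TopologicalSpace N] [DiscreteTopology N]
      (τ : DiscreteGaloisModule K N) (w : InfinitePlace K) (d : contTwoCocycles τ.toTopRep),
      galoisCohomology.localization τ (Sum.inl w) 2 (twoCocycleClass τ.toTopRep d) =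
        twoCocycleClass (DiscreteGaloisModule.toTopRep (τ.toLocal (Sum.inl w)))
          (contTwoCocycles.pullback (absGaloisRestrict K (Place.Completion (Sum.inl w : Place K)))
            (X := τ.toTopRep) (Y := DiscreteGaloisModule.toTopRep (τ.toLocal (Sum.inl w)))
            (TopRep.ofHom ⟨ContinuousLinearMap.id ℤ N, fun _ => rfl⟩) d) :=
    fun τ w d ↦ map_twoCocycleClass _ _ _ d
  have loc₃ : ∀ {N : Type} [AddCommGroup N] [TopologicalSpace N] [DiscreteTopology N]
      (τ : DiscreteGaloisModule K N) (w : InfinitePlace K) (d : contThreeCocycles τ.toTopRep),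
      galoisCohomology.localization τ (Sum.inl w) 3 (threeCocycleClass τ.toTopRep d) =
        threeCocycleClass (DiscreteGaloisModule.toTopRep (τ.toLocal (Sum.inl w)))
          (contThreeCocycles.pullback (absGaloisRestrict K (Place.Completion (Sum.inl w : Place K)))
            (X := τ.toTopRep) (Y := DiscreteGaloisModule.toTopRep (τ.toLocal (Sum.inl w)))
            (TopRep.ofHom ⟨ContinuousLinearMap.id ℤ N, fun _ => rfl⟩) d) :=
    fun τ w d ↦ map_threeCocycleClass _ _ _ d
  -- notation for the local groups and the fixed maps `r_w : Γ_{K_w} → Γ_K`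
  set Γ := absoluteGaloisGroup K with hΓ
  let Γl : InfinitePlace K → Type := fun w => absoluteGaloisGroup (Place.Completion (Sum.inl w : Place K))
  let r : ∀ w : InfinitePlace K, Γl w →ₜ* Γ := fun w => absGaloisRestrict K (Place.Completion (Sum.inl w : Place K))
  obtain ⟨z, rfl⟩ := threeCocycleClass_surjective _ x
  /- Step 1: `g ∘ z` is locally trivial at the real places, hence (h3) a coboundary `dβ`; the corrected
  cocycle `z' = z - dβ̃` (same class) takes values in `ker g = im f`: `z' = f ∘ a`, `a ∈ Z³(Γ_K, M₁)`. -/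
  have hgz : threeCocycleClass ρ₃.toTopRep
      (contThreeCocycles.pullback (ContinuousMonoidHom.id Γ) (resIdHom g) z) = 0 := by
    refine h3 _ fun w hw => ?_
    have hxw := hx w hw
    rw [loc₃] at hxw ⊢
    obtain ⟨γ, hγ⟩ := (threeCocycleClass_eq_zero_iff_dTwo _ _).1 hxw
    refine (threeCocycleClass_eq_zero_iff_dTwo _ _).2
      ⟨(⟨g.hom, g.hom.continuous⟩ : C(M₂, M₃)).comp γ, fun σ τ υ => ?_⟩
    have hγ' : z.1 (r w σ, r w τ, r w υ) =
        dTwo (DiscreteGaloisModule.toTopRep (ρ₂.toLocal (Sum.inl w))) γ σ τ υ := hγ σ τ υ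
    change g.hom (z.1 (r w σ, r w τ, r w υ)) = _
    rw [hγ', dTwo_apply, dTwo_apply, map_sub, map_add, map_sub]
    change g.hom (ρ₂ (r w σ) (γ (τ, υ))) - _ + _ - _ = ρ₃ (r w σ) (g.hom (γ (τ, υ))) - _ + _ - _
    rw [ContinuousRep.hom_comm_apply g (r w σ)]
    rfl
  obtain ⟨β, hβ⟩ := (threeCocycleClass_eq_zero_iff_dTwo _ _).1 hgz
  have hβ' : ∀ σ τ υ, g.hom (z.1 (σ, τ, υ)) = dTwo ρ₃.toTopRep β σ τ υ := fun σ τ υ => hβ σ τ υ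
  let βt : C(Γ × Γ, M₂) := ⟨h.lift ∘ β, (continuous_of_discreteTopology (f := h.lift)).comp β.continuous⟩
  have hβt : ∀ p, g.hom (βt p) = β p := fun p => h.g_lift _
  have hgd : ∀ (b : C(Γ × Γ, M₂)) (σ τ υ : Γ), g.hom (dTwo ρ₂.toTopRep b σ τ υ) =
      dTwo ρ₃.toTopRep ((⟨g.hom, g.hom.continuous⟩ : C(M₂, M₃)).comp b) σ τ υ := fun b σ τ υ => by
    rw [dTwo_apply, dTwo_apply, map_sub, map_add, map_sub, TopRep.hom_comm_apply g σ]
    rfl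
  let dβ : contThreeCocycles ρ₂.toTopRep :=
    ⟨⟨fun p => dTwo ρ₂.toTopRep βt p.1 p.2.1 p.2.2, IsSES.continuous_dTwo βt⟩,
      IsSES.dTwo_mem_contThreeCocycles βt⟩
  have hdβ : threeCocycleClass ρ₂.toTopRep dβ = 0 :=
    (threeCocycleClass_eq_zero_iff_dTwo _ _).2 ⟨βt, fun _ _ _ => rfl⟩
  let z' : contThreeCocycles ρ₂.toTopRep := z - dβ
  have hz' : ∀ σ τ υ, z'.1 (σ, τ, υ) = z.1 (σ, τ, υ) - dTwo ρ₂.toTopRep βt σ τ υ := fun _ _ _ => rfl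
  have hz'g : ∀ p, g.hom (z'.1 p) = 0 := fun ⟨σ, τ, υ⟩ => by
    rw [hz', map_sub, hβ', hgd, sub_eq_zero]
    congr 1
    exact ContinuousMap.ext fun p => (hβt p).symm
  let a : contThreeCocycles ρ₁.toTopRep :=
    ⟨⟨h.inv ∘ z'.1, (continuous_of_discreteTopology (f := h.inv)).comp z'.1.continuous⟩, fun σ τ υ ω => by
      apply h.injective
      have key := z'.2 σ τ υ ω
      change ρ₂ σ (z'.1 (τ, υ, ω)) + z'.1 (σ, τ * υ, ω) + z'.1 (σ, τ, υ) =
        z'.1 (σ * τ, υ, ω) + z'.1 (σ, τ, υ * ω) at key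
      change f.hom (ρ₁ σ (h.inv (z'.1 (τ, υ, ω))) + h.inv (z'.1 (σ, τ * υ, ω)) + h.inv (z'.1 (σ, τ, υ))) =
        f.hom (h.inv (z'.1 (σ * τ, υ, ω)) + h.inv (z'.1 (σ, τ, υ * ω)))
      rw [map_add, map_add, map_add, ContinuousRep.hom_comm_apply f σ, h.f_inv (hz'g _), h.f_inv (hz'g _),
        h.f_inv (hz'g _), h.f_inv (hz'g _), h.f_inv (hz'g _)]
      exact key⟩
  have hfa : ∀ p, f.hom (a.1 p) = z'.1 p := fun p => h.f_inv (hz'g p)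
  /- Step 2: at each real place `w`, `z'|_w = dγ_w` with `g ∘ γ_w ∈ Z²(K_w, M₃)`. -/
  have hloc' : ∀ w : InfinitePlace K, w.IsReal → ∃ γ : C(Γl w × Γl w, M₂), ∀ σ τ υ,
      z'.1 (r w σ, r w τ, r w υ) = dTwo (DiscreteGaloisModule.toTopRep (ρ₂.toLocal (Sum.inl w))) γ σ τ υ := by
    intro w hw
    have hxw := hx w hw
    rw [loc₃] at hxw
    obtain ⟨γ, hγ⟩ := (threeCocycleClass_eq_zero_iff_dTwo _ _).1 hxw
    refine ⟨γ - βt.comp ((r w : C(Γl w, Γ)).prodMap (r w : C(Γl w, Γ))), fun σ τ υ => ?_⟩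
    have hγ' : z.1 (r w σ, r w τ, r w υ) =
        dTwo (DiscreteGaloisModule.toTopRep (ρ₂.toLocal (Sum.inl w))) γ σ τ υ := hγ σ τ υ
    rw [dTwo_sub, hz', hγ']
    congr 1
    rw [dTwo_apply, dTwo_apply]
    change _ = ρ₂ (r w σ) (βt (r w τ, r w υ)) - βt (r w (σ * τ), r w υ) + βt (r w σ, r w (τ * υ)) -
      βt (r w σ, r w τ)
    rw [map_mul, map_mul]
    rfl
  choose γ hγ using hloc'
  -- the local `2`-cocycles `g ∘ γ_w` and the family `r` fed to (h2)
  have hgγ : ∀ (w : InfinitePlace K) (hw : w.IsReal),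
      (⟨g.hom, g.hom.continuous⟩ : C(M₂, M₃)).comp (γ w hw) ∈
        contTwoCocycles (DiscreteGaloisModule.toTopRep (ρ₃.toLocal (Sum.inl w))) := fun w hw => by
    refine (mem_contTwoCocycles_iff_dTwo _ _).2 fun σ τ υ => ?_
    have e1 : dTwo (DiscreteGaloisModule.toTopRep (ρ₃.toLocal (Sum.inl w)))
        ((⟨g.hom, g.hom.continuous⟩ : C(M₂, M₃)).comp (γ w hw)) σ τ υ =
        g.hom (dTwo (DiscreteGaloisModule.toTopRep (ρ₂.toLocal (Sum.inl w))) (γ w hw) σ τ υ) := by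
      rw [dTwo_apply, dTwo_apply, map_sub, map_add, map_sub]
      change ρ₃ (r w σ) (g.hom (γ w hw (τ, υ))) - _ + _ - _ = g.hom (ρ₂ (r w σ) (γ w hw (τ, υ))) - _ + _ - _
      rw [ContinuousRep.hom_comm_apply g (r w σ)]
      rfl
    rw [e1, ← hγ w hw, hz'g]
  let rr : ∀ w : InfinitePlace K, galoisCohomology (ρ₃.toLocal (Sum.inl w)) 2 := fun w =>
    if hw : w.IsReal then
      twoCocycleClass (DiscreteGaloisModule.toTopRep (ρ₃.toLocal (Sum.inl w))) ⟨_, hgγ w hw⟩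
    else 0
  have hrr : ∀ (w : InfinitePlace K) (hw : w.IsReal),
      rr w = twoCocycleClass (DiscreteGaloisModule.toTopRep (ρ₃.toLocal (Sum.inl w))) ⟨_, hgγ w hw⟩ :=
    fun w hw => dif_pos hw
  /- Step 3: one global `c = [ψ] ∈ H²(K, M₃)` with `[ψ|_w] = [g ∘ γ_w]` at the real places (h2); its connecting
  cocycle `e = f⁻¹(dψ̃) ∈ Z³(Γ_K, M₁)`. -/
  obtain ⟨c, hc⟩ := h2 rr
  obtain ⟨ψ, rfl⟩ := twoCocycleClass_surjective _ c
  let ψt : C(Γ × Γ, M₂) := ⟨h.lift ∘ ψ.1, (continuous_of_discreteTopology (f := h.lift)).comp ψ.1.continuous⟩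
  have hψt : ∀ p, g.hom (ψt p) = ψ.1 p := fun p => h.g_lift _
  have hdψ : ∀ σ τ υ, g.hom (dTwo ρ₂.toTopRep ψt σ τ υ) = 0 := fun σ τ υ => by
    rw [dTwo_apply, map_sub, map_add, map_sub, TopRep.hom_comm_apply g σ, hψt, hψt, hψt, hψt]
    exact dTwo_coe_contTwoCocycles ρ₃.toTopRep ψ σ τ υ
  let e : contThreeCocycles ρ₁.toTopRep :=
    ⟨⟨fun p => h.inv (dTwo ρ₂.toTopRep ψt p.1 p.2.1 p.2.2),
        (continuous_of_discreteTopology (f := h.inv)).comp (IsSES.continuous_dTwo ψt)⟩, fun σ τ υ ω => by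
      apply h.injective
      have key := IsSES.dTwo_mem_contThreeCocycles (ρ₂ := ρ₂) ψt σ τ υ ω
      change ρ₂ σ (dTwo ρ₂.toTopRep ψt τ υ ω) + dTwo ρ₂.toTopRep ψt σ (τ * υ) ω +
          dTwo ρ₂.toTopRep ψt σ τ υ =
        dTwo ρ₂.toTopRep ψt (σ * τ) υ ω + dTwo ρ₂.toTopRep ψt σ τ (υ * ω) at key
      change f.hom (ρ₁ σ (h.inv (dTwo ρ₂.toTopRep ψt τ υ ω)) + h.inv (dTwo ρ₂.toTopRep ψt σ (τ * υ) ω) +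
          h.inv (dTwo ρ₂.toTopRep ψt σ τ υ)) =
        f.hom (h.inv (dTwo ρ₂.toTopRep ψt (σ * τ) υ ω) + h.inv (dTwo ρ₂.toTopRep ψt σ τ (υ * ω)))
      rw [map_add, map_add, map_add, ContinuousRep.hom_comm_apply f σ, h.f_inv (hdψ _ _ _),
        h.f_inv (hdψ _ _ _), h.f_inv (hdψ _ _ _), h.f_inv (hdψ _ _ _), h.f_inv (hdψ _ _ _)]
      exact key⟩
  have hfe : ∀ σ τ υ, f.hom (e.1 (σ, τ, υ)) = dTwo ρ₂.toTopRep ψt σ τ υ := fun σ τ υ => h.f_inv (hdψ σ τ υ)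
  /- Step 4: `a' = a - e` still satisfies `f_*[a'] = x`. -/
  let a' : contThreeCocycles ρ₁.toTopRep := a - e
  have ha' : ∀ σ τ υ, a'.1 (σ, τ, υ) = a.1 (σ, τ, υ) - e.1 (σ, τ, υ) := fun _ _ _ => rfl
  let dψ : contThreeCocycles ρ₂.toTopRep :=
    ⟨⟨fun p => dTwo ρ₂.toTopRep ψt p.1 p.2.1 p.2.2, IsSES.continuous_dTwo ψt⟩,
      IsSES.dTwo_mem_contThreeCocycles ψt⟩
  have hdψ0 : threeCocycleClass ρ₂.toTopRep dψ = 0 :=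
    (threeCocycleClass_eq_zero_iff_dTwo _ _).2 ⟨ψt, fun _ _ _ => rfl⟩
  have hfa' : cohomologyMap f 3 (threeCocycleClass ρ₁.toTopRep a') = threeCocycleClass ρ₂.toTopRep z := by
    rw [cohomologyMap_threeCocycleClass]
    have hp : contThreeCocycles.pullback (ContinuousMonoidHom.id Γ) (resIdHom f) a' = z' - dψ :=
      Subtype.ext (ContinuousMap.ext fun ⟨σ, τ, υ⟩ => by
        rw [pullback₃_id_resIdHom_apply, ha', map_sub, hfa, hfe]
        rfl)
    rw [hp, threeCocycleClass_sub, threeCocycleClass_sub, hdβ, hdψ0, sub_zero, sub_zero]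
  /- Step 5: `[a']` is locally trivial at every real place. -/
  have ha'loc : ∀ w : InfinitePlace K, w.IsReal →
      galoisCohomology.localization ρ₁ (Sum.inl w) 3 (threeCocycleClass ρ₁.toTopRep a') = 0 := by
    intro w hw
    -- `[ψ|_w] = [g ∘ γ_w]`: the difference is the coboundary of some `θ : Γ_{K_w} → M₃`
    have hcw := hc w hw
    rw [hrr w hw, loc₂] at hcw
    have hcw' : twoCocycleClass (DiscreteGaloisModule.toTopRep (ρ₃.toLocal (Sum.inl w)))
        (contTwoCocycles.pullback (r w) (X := ρ₃.toTopRep)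
            (Y := DiscreteGaloisModule.toTopRep (ρ₃.toLocal (Sum.inl w)))
            (TopRep.ofHom ⟨ContinuousLinearMap.id ℤ M₃, fun _ => rfl⟩) ψ - ⟨_, hgγ w hw⟩) = 0 := by
      rw [twoCocycleClass_sub, sub_eq_zero]
      exact hcw
    obtain ⟨θ, hθ⟩ := (twoCocycleClass_eq_zero_iff _ _).1 hcw'
    have hθ' : ∀ σ τ, ψ.1 (r w σ, r w τ) - g.hom (γ w hw (σ, τ)) =
        ρ₃ (r w σ) (θ τ) - θ (σ * τ) + θ σ := fun σ τ => hθ σ τ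
    let θt : C(Γl w, M₂) := ⟨h.lift ∘ θ, (continuous_of_discreteTopology (f := h.lift)).comp θ.continuous⟩
    have hθt : ∀ σ, g.hom (θt σ) = θ σ := fun σ => h.g_lift _
    -- `κ⁰ = γ_w - ψ̃|_w + dθ̃` takes values in `ker g = im f`
    let κ₀ : C(Γl w × Γl w, M₂) :=
      γ w hw - ψt.comp ((r w : C(Γl w, Γ)).prodMap (r w : C(Γl w, Γ))) +
        ((ρ₂.toLocal (Sum.inl w)).twoCoboundary θt : contTwoCocycles _).1
    have hκ₀ : ∀ σ τ, κ₀ (σ, τ) =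
        γ w hw (σ, τ) - ψt (r w σ, r w τ) + (ρ₂ (r w σ) (θt τ) - θt (σ * τ) + θt σ) := fun σ τ => rfl
    have hκ₀g : ∀ σ τ, g.hom (κ₀ (σ, τ)) = 0 := fun σ τ => by
      rw [hκ₀, map_add, map_sub, map_add, map_sub, ContinuousRep.hom_comm_apply g (r w σ), hψt, hθt, hθt,
        hθt, ← hθ']
      abel
    let κ : C(Γl w × Γl w, M₁) := ⟨h.inv ∘ κ₀, (continuous_of_discreteTopology (f := h.inv)).comp κ₀.continuous⟩
    have hfκ : ∀ p, f.hom (κ p) = κ₀ p := fun p => h.f_inv (by obtain ⟨σ, τ⟩ := p; exact hκ₀g σ τ)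
    rw [loc₃]
    refine (threeCocycleClass_eq_zero_iff_dTwo _ _).2 ⟨κ, fun σ τ υ => ?_⟩
    apply h.injective
    change f.hom (a'.1 (r w σ, r w τ, r w υ)) =
      f.hom (dTwo (DiscreteGaloisModule.toTopRep (ρ₁.toLocal (Sum.inl w))) κ σ τ υ)
    have hfd : f.hom (dTwo (DiscreteGaloisModule.toTopRep (ρ₁.toLocal (Sum.inl w))) κ σ τ υ) =
        dTwo (DiscreteGaloisModule.toTopRep (ρ₂.toLocal (Sum.inl w))) κ₀ σ τ υ := by
      rw [dTwo_apply, dTwo_apply, map_sub, map_add, map_sub]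
      change f.hom (ρ₁ (r w σ) (κ (τ, υ))) - _ + _ - _ = ρ₂ (r w σ) (κ₀ (τ, υ)) - _ + _ - _
      rw [ContinuousRep.hom_comm_apply f (r w σ), hfκ, hfκ, hfκ, hfκ]
    rw [hfd, ha', map_sub, hfa, hfe, hγ w hw]
    -- `dκ⁰ = dγ_w - d(ψ̃|_w) + ddθ̃ = dγ_w - (dψ̃)|_w`
    have hsplit : dTwo (DiscreteGaloisModule.toTopRep (ρ₂.toLocal (Sum.inl w))) κ₀ σ τ υ =
        dTwo (DiscreteGaloisModule.toTopRep (ρ₂.toLocal (Sum.inl w))) (γ w hw) σ τ υ -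
          dTwo (DiscreteGaloisModule.toTopRep (ρ₂.toLocal (Sum.inl w)))
            (ψt.comp ((r w : C(Γl w, Γ)).prodMap (r w : C(Γl w, Γ)))) σ τ υ +
          dTwo (DiscreteGaloisModule.toTopRep (ρ₂.toLocal (Sum.inl w)))
            ((ρ₂.toLocal (Sum.inl w)).twoCoboundary θt : contTwoCocycles _).1 σ τ υ := by
      rw [← dTwo_sub, ← dTwo_add]
    rw [hsplit, dTwo_coe_contTwoCocycles, add_zero]
    congr 1
    rw [dTwo_apply, dTwo_apply]
    change _ = ρ₂ (r w σ) (ψt (r w τ, r w υ)) - ψt (r w (σ * τ), r w υ) + ψt (r w σ, r w (τ * υ)) -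
      ψt (r w σ, r w τ)
    rw [map_mul, map_mul]
    rfl
  /- Step 6: (h1) kills `[a']`, hence `x = f_*[a'] = 0`. -/
  have ha'0 : threeCocycleClass ρ₁.toTopRep a' = 0 := h1 _ ha'loc
  rw [← hfa', ha'0, map_zero]
  rfl

end Extension

/-! ## §2 The same step on the per-module instances of the two named facts -/

section NamedShape

variable {K : Type} [Field K] [NumberField K]
variable {M₁ M₂ M₃ : Type} [AddCommGroup M₁] [TopologicalSpace M₁] [DiscreteTopology M₁]
  [AddCommGroup M₂] [TopologicalSpace M₂] [DiscreteTopology M₂]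
  [AddCommGroup M₃] [TopologicalSpace M₃] [DiscreteTopology M₃]
variable {ρ₁ : DiscreteGaloisModule K M₁} {ρ₂ : DiscreteGaloisModule K M₂} {ρ₃ : DiscreteGaloisModule K M₃}
variable {f : ρ₁.toTopRep ⟶ ρ₂.toTopRep} {g : ρ₂.toTopRep ⟶ ρ₃.toTopRep}

end NamedShape

end Literature.NumberTheory.GaloisCohomology.PoitouTateFinite.SignedEC.ShaThree

end Part1

/-!
## Part 2 — port of `Summits/BirchSwinnertonDyer/BirchSwinnertonDyer/Theorems/ThetaPartnerAtTwoSignedControlAtTwoShaThreePGroup.lean` (1 declarations kept)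

# Poitou–Tate in degree `3` at the real places over a `2`-extension: dévissage to the trivial module of order `2` (K4 `SignedControlAtTwo` stub 3 `stub_poitouTateThreeRealRat`; Milne I Thm. 4.10 (c), `r = 3`)

Declarations of this Part (verbatim port; each keeps its own docstring and citation): `realThree_injective_of_pGroup_quotient`.

Reference keys (see `references.bib` and the declarations' citations): [MilneADT2006], [SerreGaloisCohomology1997].
-/

section Part2

set_option autoImplicit false
open _root_.CategoryTheory _root_.NumberField _root_.Field _root_.Function _root_.MulAction
open _root_.TopRep _root_.ContRepresentation _root_.ContinuousCohomology
open Literature.NumberTheory.GaloisRepresentations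
open Literature.NumberTheory.GaloisCohomology

namespace Literature.NumberTheory.GaloisCohomology.PoitouTateFinite.SignedEC.ShaThree

section Devissage

variable {F : Type} [Field F] [NumberField F]

/-- **Dévissage over a `2`-extension for Milne I Thm. 4.10 (c)₃.**  `N₀ ⊴ Γ_F` with `Γ_F/N₀` a finite `2`-group;
(hP) real-place injectivity of `H³(F, W)` for every ORDER-`2` module `W` with trivial action; (h416) Milne I Cor. 4.16
over `F`.  Then real-place injectivity of `H³(F, B)` holds for every finite discrete `2`-primary `B` on which `N₀` acts
trivially. [cite: MilneADT2006, Ch. I, Thm. 4.10 (c) and Cor. 4.16] [cite: SerreGaloisCohomology1997, I §3.3 Cor. 1] -/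
theorem realThree_injective_of_pGroup_quotient (N₀ : Subgroup (absoluteGaloisGroup F)) [N₀.Normal]
    [Finite (absoluteGaloisGroup F ⧸ N₀)] (hQ : IsPGroup 2 (absoluteGaloisGroup F ⧸ N₀))
    (hP : ∀ (W : Type) [AddCommGroup W] [TopologicalSpace W] [DiscreteTopology W] [Finite W]
      (σ : DiscreteGaloisModule F W), (∀ (g : absoluteGaloisGroup F) (w : W), σ g w = w) → Nat.card W = 2 →
        ∀ c : galoisCohomology σ 3,
          (∀ w : InfinitePlace F, w.IsReal → galoisCohomology.localization σ (Sum.inl w) 3 c = 0) → c = 0)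
    (h416 : poitouTate_two_realPlaces_surjective F)
    (B : Type) [AddCommGroup B] [TopologicalSpace B] [DiscreteTopology B] [Finite B]
    (τ : DiscreteGaloisModule F B) (hB : IsPrimaryTorsion 2 B)
    (hN₀ : ∀ g ∈ N₀, ∀ b : B, τ g b = b) :
    ∀ c : galoisCohomology τ 3,
      (∀ w : InfinitePlace F, w.IsReal → galoisCohomology.localization τ (Sum.inl w) 3 c = 0) → c = 0 := by
  classical
  haveI : CompactSpace (absoluteGaloisGroup F) := absoluteGaloisGroup_compactSpace F
  suffices key : ∀ (n : ℕ) (B : Type) [AddCommGroup B] [TopologicalSpace B] [DiscreteTopology B]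
      [Finite B] (τ : DiscreteGaloisModule F B), IsPrimaryTorsion 2 B →
      (∀ g ∈ N₀, ∀ b : B, τ g b = b) → Nat.card B = n →
      ∀ c : galoisCohomology τ 3,
        (∀ w : InfinitePlace F, w.IsReal → galoisCohomology.localization τ (Sum.inl w) 3 c = 0) → c = 0 from
    key _ B τ hB hN₀ rfl
  intro n
  induction n using Nat.strong_induction_on with
  | _ n ih =>
    intro B _ _ _ _ τ hB hN₀ hn c hc
    by_cases hsub : Subsingleton B
    · exact (subsingleton_continuousCohomology_of_subsingleton τ.toTopRep 2).elim _ _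
    · haveI : Nontrivial B := not_subsingleton_iff_nontrivial.1 hsub
      obtain ⟨b, hb0, hbfix⟩ := exists_ne_zero_forall_apply_eq N₀ hQ τ hB hN₀
      obtain ⟨b₁, hb₁0, hpb₁, hb₁fix⟩ := exists_line τ hB b hb0 hbfix
      let W₁ : Submodule ℤ B := Submodule.span ℤ {b₁}
      have hW₁ : ∀ g, W₁ ≤ W₁.comap (τ g) := span_singleton_le_comap τ b₁ hb₁fix
      have hSES := isSES_subtype_mkQ τ W₁ hW₁
      have hcardW : Nat.card W₁ = 2 := natCard_span_singleton b₁ hb₁0 hpb₁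
      haveI : Finite W₁ := Subtype.finite
      -- the line: hypothesis (hP)
      have h₁ : ∀ a : galoisCohomology (show DiscreteGaloisModule F W₁ from τ.subrepresentation W₁ hW₁) 3,
          (∀ w : InfinitePlace F, w.IsReal →
            galoisCohomology.localization (show DiscreteGaloisModule F W₁ from τ.subrepresentation W₁ hW₁)
              (Sum.inl w) 3 a = 0) → a = 0 :=
        hP W₁ (τ.subrepresentation W₁ hW₁) (subrepresentation_span_apply τ b₁ hb₁fix) hcardW
      -- the quotient, by induction
      haveI : Finite (B ⧸ W₁) := Finite.of_surjective _ (Submodule.Quotient.mk_surjective W₁)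
      have hlt : Nat.card (B ⧸ W₁) < n := by
        have hmul : Nat.card B = Nat.card (B ⧸ W₁) * Nat.card W₁ :=
          AddSubgroup.card_eq_card_quotient_mul_card_addSubgroup W₁.toAddSubgroup
        rw [hn, hcardW] at hmul
        rw [hmul]
        exact (Nat.lt_mul_iff_one_lt_right Nat.card_pos).2 one_lt_two
      have htriv : ∀ g ∈ N₀, ∀ x : B ⧸ W₁, τ.quotient W₁ hW₁ g x = x := fun g hg x => by
        induction x using Submodule.Quotient.induction_on with
        | _ m => rw [ContinuousRep.quotient_apply_mk, hN₀ g hg m]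
      have h₃ : ∀ a : galoisCohomology (show DiscreteGaloisModule F (B ⧸ W₁) from τ.quotient W₁ hW₁) 3,
          (∀ w : InfinitePlace F, w.IsReal →
            galoisCohomology.localization (show DiscreteGaloisModule F (B ⧸ W₁) from τ.quotient W₁ hW₁)
              (Sum.inl w) 3 a = 0) → a = 0 :=
        ih _ hlt (B ⧸ W₁) (τ.quotient W₁ hW₁) (hB.quotient W₁) htriv rfl
      -- Cor. 4.16 at the quotient: hypothesis (h416)
      have h₂ := h416 (B ⧸ W₁) (τ.quotient W₁ hW₁)
      exact IsSES.eq_zero_of_forall_localization_inl_three hSES h₁ h₃ h₂ c hc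

end Devissage

end Literature.NumberTheory.GaloisCohomology.PoitouTateFinite.SignedEC.ShaThree

end Part2

/-!
## Part 3 — port of `Summits/BirchSwinnertonDyer/BirchSwinnertonDyer/Theorems/ThetaPartnerAtTwoSignedControlAtTwoShaThreeOddDescent.lean` (5 declarations kept)

# Poitou–Tate in degree `3` at the real places DESCENDS along an odd-degree extension (K4 `SignedControlAtTwo` stub 3 `stub_poitouTateThreeRealRat`; Milne I Thm. 4.10 (c), `r = 3`)

Declarations of this Part (verbatim port; each keeps its own docstring and citation): `map_eq_map_of_inner_three`, `pullback_three_eq_zero_of_forall_localization_inl`, `localization_inl_res_three_eq_zero`, `eq_zero_of_res_eq_zero_of_psmul_eq_zero`, `realThree_injective_of_odd_extension`.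

Reference keys (see `references.bib` and the declarations' citations): [SerreLocalFields1979], [SerreGaloisCohomology1997], [MilneADT2006], [ArtinSchreier1927Kennzeichnung].
-/

section Part3

set_option autoImplicit false
open _root_.CategoryTheory _root_.NumberField _root_.Field _root_.Function
open _root_.TopRep _root_.ContRepresentation _root_.ContinuousCohomology
open Literature.NumberTheory.GaloisRepresentations
open Literature.NumberTheory.GaloisCohomology

universe u v

namespace Literature.NumberTheory.GaloisCohomology.PoitouTateFinite.SignedEC.ShaThree

/-! ## §1 Inner automorphisms act trivially on `H³` -/

section Inner

variable {R : Type u} [CommRing R] [TopologicalSpace R]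
variable {G : Type v} [Group G] [TopologicalSpace G] [IsTopologicalGroup G] [LocallyCompactSpace G]
variable {H : Type v} [Group H] [TopologicalSpace H] [IsTopologicalGroup H] [LocallyCompactSpace H]
variable {X : TopRep.{v} R G} {Y : TopRep.{v} R H}

/-- **Inner automorphisms act trivially on `H³`** (Serre, *Corps locaux*, VII §5 Prop. 3), relative form as in the
tree's `map_eq_map_of_inner_two`: for `ι, θ : H → G` with `θ(x) = g⁻¹ ι(x) g` and coefficient maps with
`f₁ = f₂ ∘ g`, the maps `H³(G, X) → H³(H, Y)` induced by `(θ, f₁)` and `(ι, f₂)` agree.  On `3`-cocycles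
`g·z(σ^g, τ^g, υ^g) - z(σ, τ, υ) = (dh)(σ, τ, υ)` with `h(σ, τ) = z(g, σ^g, τ^g) - z(σ, g, τ^g) + z(σ, τ, g)`,
`σ^g = g⁻¹ σ g` (four instances of the cocycle identity). [cite: SerreLocalFields1979, VII §5 Prop. 3] -/
theorem map_eq_map_of_inner_three (g : G) (ι θ : H →ₜ* G) (hθ : ∀ x, θ x = g⁻¹ * ι x * g)
    (f₁ : res (θ : H →* G) X ⟶ Y) (f₂ : res (ι : H →* G) X ⟶ Y)
    (hf : ∀ v, f₁.hom v = f₂.hom (X.ρ g v)) (x : continuousCohomology 3 X) :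
    ContinuousCohomology.map θ f₁ 3 x = ContinuousCohomology.map ι f₂ 3 x := by
  obtain ⟨z, rfl⟩ := threeCocycleClass_surjective X x
  rw [map_threeCocycleClass, map_threeCocycleClass, ← sub_eq_zero, ← threeCocycleClass_sub,
    threeCocycleClass_eq_zero_iff_dTwo]
  let b : C(H × H, Y) := ⟨fun p => f₂.hom (z.1 (g, g⁻¹ * ι p.1 * g, g⁻¹ * ι p.2 * g) -
      z.1 (ι p.1, g, g⁻¹ * ι p.2 * g) + z.1 (ι p.1, ι p.2, g)),
    f₂.hom.continuous.comp (((z.1.continuous.comp (continuous_const.prodMk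
      (((continuous_const.mul (ι.continuous.comp continuous_fst)).mul continuous_const).prodMk
        ((continuous_const.mul (ι.continuous.comp continuous_snd)).mul continuous_const)))).sub
      (z.1.continuous.comp ((ι.continuous.comp continuous_fst).prodMk (continuous_const.prodMk
        ((continuous_const.mul (ι.continuous.comp continuous_snd)).mul continuous_const))))).add
      (z.1.continuous.comp ((ι.continuous.comp continuous_fst).prodMk
        ((ι.continuous.comp continuous_snd).prodMk continuous_const))))⟩
  refine ⟨b, fun σ τ υ => ?_⟩
  rw [dTwo_apply]
  change f₁.hom (z.1 (θ σ, θ τ, θ υ)) - f₂.hom (z.1 (ι σ, ι τ, ι υ)) =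
    Y.ρ σ (f₂.hom (z.1 (g, g⁻¹ * ι τ * g, g⁻¹ * ι υ * g) - z.1 (ι τ, g, g⁻¹ * ι υ * g) + z.1 (ι τ, ι υ, g))) -
      f₂.hom (z.1 (g, g⁻¹ * ι (σ * τ) * g, g⁻¹ * ι υ * g) - z.1 (ι (σ * τ), g, g⁻¹ * ι υ * g) +
        z.1 (ι (σ * τ), ι υ, g)) +
      f₂.hom (z.1 (g, g⁻¹ * ι σ * g, g⁻¹ * ι (τ * υ) * g) - z.1 (ι σ, g, g⁻¹ * ι (τ * υ) * g) +
        z.1 (ι σ, ι (τ * υ), g)) -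
      f₂.hom (z.1 (g, g⁻¹ * ι σ * g, g⁻¹ * ι τ * g) - z.1 (ι σ, g, g⁻¹ * ι τ * g) + z.1 (ι σ, ι τ, g))
  -- four instances of the `3`-cocycle identity
  have I1 := z.2 (ι σ) (ι τ) (ι υ) g
  have I2 := z.2 (ι σ) (ι τ) g (g⁻¹ * ι υ * g)
  have I3 := z.2 (ι σ) g (g⁻¹ * ι τ * g) (g⁻¹ * ι υ * g)
  have I4 := z.2 g (g⁻¹ * ι σ * g) (g⁻¹ * ι τ * g) (g⁻¹ * ι υ * g)
  have e1 : ι τ * g = g * (g⁻¹ * ι τ * g) := by group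
  have e2 : g * (g⁻¹ * ι υ * g) = ι υ * g := by group
  have e3 : g⁻¹ * ι τ * g * (g⁻¹ * ι υ * g) = g⁻¹ * ι (τ * υ) * g := by rw [map_mul]; group
  have e4 : ι σ * g = g * (g⁻¹ * ι σ * g) := by group
  have e5 : g⁻¹ * ι σ * g * (g⁻¹ * ι τ * g) = g⁻¹ * ι (σ * τ) * g := by rw [map_mul]; group
  rw [← map_mul ι, ← map_mul ι] at I1
  rw [e1, e2, ← map_mul ι] at I2
  rw [e4, e3] at I3
  rw [e5, e3] at I4
  rw [hf, hθ, hθ, hθ, ← TopRep.hom_comm_apply f₂ σ, ← map_sub, ← map_sub, ← map_add, ← map_sub]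
  refine congrArg f₂.hom ?_
  change X.ρ g (z.1 (g⁻¹ * ι σ * g, g⁻¹ * ι τ * g, g⁻¹ * ι υ * g)) - z.1 (ι σ, ι τ, ι υ) =
    X.ρ (ι σ) (z.1 (g, g⁻¹ * ι τ * g, g⁻¹ * ι υ * g) - z.1 (ι τ, g, g⁻¹ * ι υ * g) + z.1 (ι τ, ι υ, g)) -
      (z.1 (g, g⁻¹ * ι (σ * τ) * g, g⁻¹ * ι υ * g) - z.1 (ι (σ * τ), g, g⁻¹ * ι υ * g) +
        z.1 (ι (σ * τ), ι υ, g)) +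
      (z.1 (g, g⁻¹ * ι σ * g, g⁻¹ * ι (τ * υ) * g) - z.1 (ι σ, g, g⁻¹ * ι (τ * υ) * g) +
        z.1 (ι σ, ι (τ * υ), g)) -
      (z.1 (g, g⁻¹ * ι σ * g, g⁻¹ * ι τ * g) - z.1 (ι σ, g, g⁻¹ * ι τ * g) + z.1 (ι σ, ι τ, g))
  rw [map_add, map_sub, eq_sub_of_add_eq (eq_sub_of_add_eq I1), eq_sub_of_add_eq (eq_sub_of_add_eq I2),
    eq_sub_of_add_eq (eq_sub_of_add_eq I3), eq_sub_of_add_eq (eq_sub_of_add_eq I4)]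
  abel

end Inner

/-! ## §2 Pull-back along a homomorphism from a group of order `≤ 2` hitting an involution -/

section Involution

variable {K : Type} [Field K] [NumberField K]
variable {M : Type} [AddCommGroup M] [TopologicalSpace M] [DiscreteTopology M]

/-- **A class of `H³(K, M)` vanishing at every real place vanishes on every decomposition group of a real place,
however embedded.**  Let `ψ : Γ_L →ₜ* Γ_K` be a continuous homomorphism from the absolute Galois group of a field
`L` with `Γ_L = {1, σ}` and `ψ σ` an involution of `Γ_K`.  If `x ∈ H³(K, M)` has `loc_w x = 0` at every real place
`w` of `K`, then the pull-back of `x` along `ψ` is `0`.  (`ψ σ` is a complex conjugation at some real `w₀`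
(Artin–Schreier), conjugate to the image `c` of the generator of `Γ_{K_{w₀}}`: `ψ σ = g c g⁻¹`; by §1 the
pull-back along `ψ` is the pull-back along `Γ_L ≅ Γ_{K_{w₀}} → Γ_K` twisted by `g`, which factors through
`loc_{w₀} x = 0`.) [cite: ArtinSchreier1927Kennzeichnung, Satz 4] [cite: SerreLocalFields1979, VII §5 Prop. 3]
[cite: MilneADT2006, Ch. I, Thm. 4.10 (c)] -/
theorem pullback_three_eq_zero_of_forall_localization_inl (ρ : DiscreteGaloisModule K M)
    (x : galoisCohomology ρ 3)
    (hx : ∀ w : InfinitePlace K, w.IsReal → galoisCohomology.localization ρ (Sum.inl w) 3 x = 0)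
    {L : Type} [Field L] (ψ : absoluteGaloisGroup L →ₜ* absoluteGaloisGroup K)
    (σ : absoluteGaloisGroup L) (hL : ∀ h : absoluteGaloisGroup L, h = 1 ∨ h = σ)
    (hσ1 : ψ σ ≠ 1) (hσ2 : ψ σ * ψ σ = 1) :
    galoisCohomology.pullback ρ ψ 3 x = 0 := by
  classical
  haveI : CompactSpace (absoluteGaloisGroup K) := absoluteGaloisGroup_compactSpace K
  haveI : CompactSpace (absoluteGaloisGroup L) := absoluteGaloisGroup_compactSpace L
  -- `ψ σ` is a complex conjugation at some real place `w₀`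
  obtain ⟨w₀, hw₀, hd⟩ := exists_isComplexConjugationAt_of_sq_eq_one (ψ σ) hσ1 (by rw [pow_two, hσ2])
  haveI : CompactSpace (absoluteGaloisGroup (Place.Completion (Sum.inl w₀ : Place K))) :=
    absoluteGaloisGroup_compactSpace _
  -- `Γ_{K_{w₀}} = {1, τ₀}`, and `c := res τ₀` is a complex conjugation at `w₀`, conjugate to `ψ σ`
  obtain ⟨τ₀, hτ₀, hall₀⟩ := exists_ne_one_forall_eq_of_isReal (K := K) hw₀
  set φ := absGaloisRestrict K (Place.Completion (Sum.inl w₀ : Place K)) with hφ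
  have hc : IsComplexConjugationAt hw₀ (φ τ₀) := isComplexConjugationAt_absGaloisRestrict_of_ne_one hw₀ hτ₀
  obtain ⟨g, hg⟩ := isConj_iff.1 ((hc.isConj_iff_eq hd).2 rfl)
  -- hg : g * φ τ₀ * g⁻¹ = ψ σ
  have hσσ : σ * σ = 1 := by
    rcases hL (σ * σ) with h | h
    · exact h
    · -- `σ * σ = σ` forces `σ = 1`, contradicting `ψ σ ≠ 1`
      have : σ = 1 := mul_left_cancel (a := σ) (by rw [h, mul_one])
      exact absurd (by rw [this, map_one]) hσ1
  have hττ : τ₀ * τ₀ = 1 := by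
    rcases hall₀ (τ₀ * τ₀) with h | h
    · exact h
    · have : τ₀ = 1 := mul_left_cancel (a := τ₀) (by rw [h, mul_one])
      exact absurd this hτ₀
  have hσne : σ ≠ 1 := fun h => hσ1 (by rw [h, map_one])
  -- the isomorphism `α : Γ_L → Γ_{K_{w₀}}`, `σ ↦ τ₀`
  haveI : Finite (absoluteGaloisGroup (Place.Completion (Sum.inl w₀ : Place K))) :=
    finite_absoluteGaloisGroup_placeCompletion_inl K w₀
  have hLfin : Finite (absoluteGaloisGroup L) := by
    refine Finite.of_surjective (fun b : Bool => if b then σ else 1) fun h => ?_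
    rcases hL h with rfl | rfl
    · exact ⟨false, rfl⟩
    · exact ⟨true, rfl⟩
  haveI := hLfin
  let α₀ : absoluteGaloisGroup L →* absoluteGaloisGroup (Place.Completion (Sum.inl w₀ : Place K)) :=
    { toFun := fun h => if h = 1 then 1 else τ₀
      map_one' := if_pos rfl
      map_mul' := fun a b => by
        rcases hL a with rfl | rfl <;> rcases hL b with rfl | rfl
        · simp
        · simp [hσne]
        · simp [hσne]
        · rw [hσσ, if_pos rfl, if_neg hσne]
          exact hττ.symm }
  have hα₀σ : α₀ σ = τ₀ := if_neg hσne
  let α : absoluteGaloisGroup L →ₜ* absoluteGaloisGroup (Place.Completion (Sum.inl w₀ : Place K)) :=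
    ⟨α₀, continuous_of_discreteTopology⟩
  have hασ : α σ = τ₀ := hα₀σ
  -- `ψ h = g (φ (α h)) g⁻¹` for all `h`
  have hψ : ∀ h, ψ h = g⁻¹⁻¹ * (φ.comp α) h * g⁻¹ := fun h => by
    obtain h1 | h2 := hL h
    · rw [h1, map_one, map_one, mul_one, inv_inv, mul_inv_cancel]
    · rw [h2, inv_inv]
      change ψ σ = g * φ (α σ) * g⁻¹
      rw [hασ, hg]
  -- §1: the pull-back along `ψ` is the `g`-twisted pull-back along `φ ∘ α`
  let Y : TopRep ℤ (absoluteGaloisGroup L) := DiscreteGaloisModule.toTopRep (ContinuousRep.restrict ρ ψ)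
  let f₁ : TopRep.res (ψ : absoluteGaloisGroup L →* absoluteGaloisGroup K) ρ.toTopRep ⟶ Y :=
    TopRep.ofHom ⟨ContinuousLinearMap.id ℤ M, fun _ => rfl⟩
  have hrel : ∀ (h : absoluteGaloisGroup L) (v : M), ρ g (ρ (φ (α h)) v) = ρ (ψ h) (ρ g v) := fun h v => by
    rw [hψ h, inv_inv, ← Module.End.mul_apply, ← _root_.map_mul, ← Module.End.mul_apply,
      ← _root_.map_mul, inv_mul_cancel_right]
    rfl
  let f₂ : TopRep.res ((φ.comp α : absoluteGaloisGroup L →ₜ* absoluteGaloisGroup K) :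
      absoluteGaloisGroup L →* absoluteGaloisGroup K) ρ.toTopRep ⟶ Y :=
    TopRep.ofHom ⟨⟨(ρ g : M →ₗ[ℤ] M), continuous_of_discreteTopology⟩, fun h => by
      ext v
      exact hrel h v⟩
  have hmain : galoisCohomology.pullback ρ ψ 3 x = (ContinuousCohomology.map (φ.comp α) f₂ 3).hom x := by
    change (ContinuousCohomology.map ψ f₁ 3).hom x = _
    exact map_eq_map_of_inner_three g⁻¹ (φ.comp α) ψ hψ f₁ f₂ (fun v => by
      change v = ρ g (ρ g⁻¹ v)
      rw [← Module.End.mul_apply, ← _root_.map_mul, mul_inv_cancel, _root_.map_one, Module.End.one_apply]) x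
  -- factor through `loc_{w₀} x = 0`
  let Y₀ : TopRep ℤ (absoluteGaloisGroup (Place.Completion (Sum.inl w₀ : Place K))) :=
    DiscreteGaloisModule.toTopRep (ρ.toLocal (Sum.inl w₀))
  let f₀ : TopRep.res (φ : _ →* absoluteGaloisGroup K) ρ.toTopRep ⟶ Y₀ :=
    TopRep.ofHom ⟨ContinuousLinearMap.id ℤ M, fun _ => rfl⟩
  let g₂ : TopRep.res (α : absoluteGaloisGroup L →* _) Y₀ ⟶ Y :=
    TopRep.ofHom ⟨⟨(ρ g : M →ₗ[ℤ] M), continuous_of_discreteTopology⟩, fun h => by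
      ext v
      exact hrel h v⟩
  have hcomp : ContinuousCohomology.map (φ.comp α) f₂ 3 =
      ContinuousCohomology.map φ f₀ 3 ≫ ContinuousCohomology.map α g₂ 3 := by
    rw [← ContinuousCohomology.map_comp]
    exact ContinuousCohomology.map_congr_of_eq rfl _ _ (fun _ => rfl) 3
  have hloc : (ContinuousCohomology.map φ f₀ 3).hom x = 0 := hx w₀ hw₀
  rw [hmain, hcomp]
  change (ContinuousCohomology.map α g₂ 3).hom ((ContinuousCohomology.map φ f₀ 3).hom x) = 0
  rw [hloc, map_zero]

end Involution

/-! ## §3 Restriction to a finite extension kills nothing new at the real places -/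

section ResLoc

variable {K : Type} [Field K] [NumberField K]
variable {M : Type} [AddCommGroup M] [TopologicalSpace M] [DiscreteTopology M]

/-- **`loc_{w'} ∘ Res_{F/K}` vanishes on classes vanishing at the real places of `K`.**  For a finite extension of
number fields `F/K`, a discrete `Γ_K`-module `M`, and `x ∈ H³(K, M)` with `loc_w x = 0` at every real place `w` of
`K`: `loc_{w'} (Res_{F/K} x) = 0` at every real place `w'` of `F` (the composite `Γ_{F_{w'}} → Γ_F → Γ_K` sends the
generator to an involution of `Γ_K`; §2). [cite: SerreGaloisCohomology1997, II §6.1] [cite: MilneADT2006, Ch. I, Thm. 4.10 (c)] -/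
theorem localization_inl_res_three_eq_zero (ρ : DiscreteGaloisModule K M) (F : Type) [Field F] [NumberField F]
    [Algebra K F] [Algebra.IsAlgebraic K F] (x : galoisCohomology ρ 3)
    (hx : ∀ w : InfinitePlace K, w.IsReal → galoisCohomology.localization ρ (Sum.inl w) 3 x = 0)
    (w' : InfinitePlace F) (hw' : w'.IsReal) :
    galoisCohomology.localization (ρ.restrictField F) (Sum.inl w') 3 (galoisCohomology.res ρ F 3 x) = 0 := by
  have hcomp := congrArg (fun T => T x) (galoisCohomology.res_comp ρ F (Place.Completion (Sum.inl w' : Place F)) 3)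
  change galoisCohomology.localization (ρ.restrictField F) (Sum.inl w') 3 (galoisCohomology.res ρ F 3 x) =
    galoisCohomology.pullback ρ ((absGaloisRestrict K F).comp
      (absGaloisRestrict F (Place.Completion (Sum.inl w' : Place F)))) 3 x at hcomp
  rw [hcomp]
  obtain ⟨σ, hσ, hall⟩ := exists_ne_one_forall_eq_of_isReal (K := F) hw'
  refine pullback_three_eq_zero_of_forall_localization_inl ρ x hx _ σ hall ?_ ?_
  · change absGaloisRestrict K F (absGaloisRestrict F w'.Completion σ) ≠ 1
    exact fun h => absGaloisRestrict_ne_one_of_isReal hw' hσ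
      (absGaloisRestrict_injective K F (by rw [h, map_one]))
  · change absGaloisRestrict K F (absGaloisRestrict F w'.Completion σ) *
        absGaloisRestrict K F (absGaloisRestrict F w'.Completion σ) = 1
    rw [← map_mul, absGaloisRestrict_mul_self_of_isReal hw' hσ, map_one]

end ResLoc

/-! ## §4 `Res_{F/K}` is injective on `p`-primary classes when `p ∤ [F : K]` -/

section ResInjective

variable {K : Type} [Field K] [NumberField K]
variable {M : Type} [AddCommGroup M] [TopologicalSpace M] [DiscreteTopology M]

/-- **Serre I §2.4 Prop. 9 in field form**: for a finite extension `F/K`, a class `x ∈ Hⁿ(K, M)` with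
`Res_{F/K} x = 0` and `p ^ r • x = 0` vanishes as soon as `p ∤ [F : K]` (`Cor ∘ Res = [F : K]`, Bezout).
[cite: SerreGaloisCohomology1997, I §2.4 Prop. 9 and I §3.3 Prop. 14] -/
theorem eq_zero_of_res_eq_zero_of_psmul_eq_zero (ρ : DiscreteGaloisModule K M) (F : Type) [Field F]
    [Algebra K F] [FiniteDimensional K F] {p r : ℕ} (hcop : (Module.finrank K F).Coprime p) (n : ℕ)
    (x : galoisCohomology ρ n) (hres : galoisCohomology.res ρ F n x = 0) (hp : (p ^ r) • x = 0) : x = 0 := by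
  haveI : CompactSpace (absoluteGaloisGroup K) := absoluteGaloisGroup_compactSpace K
  have h1 : resSubgroup ρ.toTopRep (absGaloisRestrict K F).range n x = 0 := by
    rw [← galoisCohomology.rangeTransport_res ρ F n x, hres, map_zero]
  have h2 : (ρ : ContinuousRep (absoluteGaloisGroup K) ℤ M).Hpullback
      (subgroupIncl (absGaloisRestrict K F).range) n x = 0 := h1
  have hopen : IsOpen ((absGaloisRestrict K F).range : Set (absoluteGaloisGroup K)) :=
    (isOpenEmbedding_absGaloisRestrict K F).isOpen_range
  have hm := index_smul_eq_zero_of_Hpullback_eq_zero_int (ρ : ContinuousRep (absoluteGaloisGroup K) ℤ M)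
    hopen n x h2
  rw [index_range_absGaloisRestrict K F] at hm
  have h := gcd_nsmul_eq_zero.2 ⟨hm, hp⟩
  rwa [(Nat.Coprime.pow_right r hcop).gcd_eq_one, one_nsmul] at h

end ResInjective

/-! ## §5 The odd-degree descent for Milne I Thm. 4.10 (c)₃ -/

section Descent

variable {K : Type} [Field K] [NumberField K]
variable {M : Type} [AddCommGroup M] [TopologicalSpace M] [DiscreteTopology M]

/-- **Odd-degree descent.**  Let `F/K` be a finite extension of number fields of ODD degree and `M` a discrete
`Γ_K`-module killed by `2 ^ r`.  If every class of `H³(F, M)` vanishing at all real places of `F` is `0`, then every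
class of `H³(K, M)` vanishing at all real places of `K` is `0`.
[cite: MilneADT2006, Ch. I, Thm. 4.10 (c)] [cite: SerreGaloisCohomology1997, I §2.4 Prop. 9] -/
theorem realThree_injective_of_odd_extension (ρ : DiscreteGaloisModule K M) (F : Type) [Field F]
    [NumberField F] [Algebra K F] [FiniteDimensional K F] (hodd : Odd (Module.finrank K F))
    {r : ℕ} (hM : ∀ m : M, (2 ^ r) • m = 0)
    (hF : ∀ y : galoisCohomology (ρ.restrictField F) 3,
      (∀ w' : InfinitePlace F, w'.IsReal →
        galoisCohomology.localization (ρ.restrictField F) (Sum.inl w') 3 y = 0) → y = 0) :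
    ∀ x : galoisCohomology ρ 3,
      (∀ w : InfinitePlace K, w.IsReal → galoisCohomology.localization ρ (Sum.inl w) 3 x = 0) → x = 0 := by
  intro x hx
  haveI : CompactSpace (absoluteGaloisGroup K) := absoluteGaloisGroup_compactSpace K
  haveI : Algebra.IsAlgebraic K F := Algebra.IsAlgebraic.of_finite K F
  have hres : galoisCohomology.res ρ F 3 x = 0 :=
    hF _ fun w' hw' => localization_inl_res_three_eq_zero ρ F x hx w' hw'
  have hcop : (Module.finrank K F).Coprime 2 := Nat.coprime_two_right.2 hodd
  -- `2 ^ r` kills the class `x` (it kills every `3`-cocycle)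
  have hp : (2 ^ r) • x = 0 := by
    obtain ⟨z, rfl⟩ := threeCocycleClass_surjective _ x
    have hz : (2 ^ r) • z = 0 :=
      Subtype.ext (ContinuousMap.ext fun q => hM (z.1 q))
    have hcl := map_nsmul (threeCocycleClassₗ ρ.toTopRep) (2 ^ r) z
    rw [hz, map_zero] at hcl
    exact hcl.symm
  exact eq_zero_of_res_eq_zero_of_psmul_eq_zero ρ F hcop 3 x hres hp

end Descent

end Literature.NumberTheory.GaloisCohomology.PoitouTateFinite.SignedEC.ShaThree

end Part3

/-!
## Part 4 — port of `Summits/BirchSwinnertonDyer/BirchSwinnertonDyer/Theorems/ThetaPartnerAtTwoSignedControlAtTwoShaThreeAssembly.lean` (5 declarations kept)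

# Milne I Thm. 4.10 (c)₃ — `H³(K, M) ↪ ⊕_{w real} H³(K_w, M)` — from the order-`2` trivial module: assembly of the dévissage (K4 `SignedControlAtTwo` stub 3 `stub_poitouTateThreeRealRat`)

Declarations of this Part (verbatim port; each keeps its own docstring and citation): `torsionBy_le_comap`, `odd_addOrderOf_of_forall_two_nsmul`, `subsingleton_three_of_forall_two_nsmul`, `realThree_injective_of_isPrimaryTorsion_two`, `poitouTate_three_realPlaces_injective_of_devissage`.

Reference keys (see `references.bib` and the declarations' citations): [MilneADT2006], [SerreGaloisCohomology1997].
-/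

section Part4

set_option autoImplicit false
open _root_.CategoryTheory _root_.NumberField _root_.Field _root_.Function
open _root_.TopRep _root_.ContRepresentation _root_.ContinuousCohomology
open Literature.NumberTheory.GaloisRepresentations
open Literature.NumberTheory.GaloisCohomology

namespace Literature.NumberTheory.GaloisCohomology.PoitouTateFinite.SignedEC.ShaThree

variable {K : Type} [Field K] [NumberField K]

/-! ## §0 Stable torsion submodules -/

section Torsion

variable {M : Type} [AddCommGroup M] [TopologicalSpace M] [DiscreteTopology M]

omit [NumberField K] in
/-- The `a`-torsion submodule is stable under every discrete `Γ_K`-module structure. [cite: SerreGaloisCohomology1997, II §4.4 Prop. 13] -/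
theorem torsionBy_le_comap (ρ : DiscreteGaloisModule K M) (a : ℤ) (g : absoluteGaloisGroup K) :
    Submodule.torsionBy ℤ M a ≤ (Submodule.torsionBy ℤ M a).comap (ρ g) := by
  intro x hx
  rw [Submodule.mem_comap, Submodule.mem_torsionBy_iff]
  rw [Submodule.mem_torsionBy_iff] at hx
  rw [← map_zsmul, hx, map_zero]

omit [Field K] [NumberField K] [TopologicalSpace M] [DiscreteTopology M] in
/-- In a group without `2`-torsion every element has odd order. [cite: SerreGaloisCohomology1997, II §4.4 Prop. 13] -/
theorem odd_addOrderOf_of_forall_two_nsmul [Finite M] (h2 : ∀ q : M, 2 • q = 0 → q = 0) (q : M) :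
    Odd (addOrderOf q) := by
  by_contra hodd
  rw [Nat.not_odd_iff_even] at hodd
  obtain ⟨k, hk⟩ := hodd
  have hpos : 0 < addOrderOf q := addOrderOf_pos q
  have hkq : k • q = 0 := h2 _ (by rw [← mul_nsmul', two_mul, ← hk]; exact addOrderOf_nsmul_eq_zero q)
  have hdvd := addOrderOf_dvd_of_nsmul_eq_zero hkq
  have hk0 : 0 < k := by omega
  have := Nat.le_of_dvd hk0 hdvd
  omega

end Torsion

/-! ## §1 Odd part: `H³(K, Q) = 0` for finite `Q` without `2`-torsion -/

section OddPart

/-- **`H³(K, Q) = 0` for a finite discrete `Γ_K`-module `Q` without `2`-torsion** (dévissage along the `p`-primary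
parts, `p` odd; Serre II §4.4 Prop. 13 `cd_p(Γ_K) ≤ 2` for `p ≠ 2`, tree `fieldCdLE_two_of_numberField_holds`).
[cite: SerreGaloisCohomology1997, II §4.4 Prop. 13] [cite: SerreGaloisCohomology1997, I §3.3] -/
theorem subsingleton_three_of_forall_two_nsmul (Q : Type) [AddCommGroup Q] [TopologicalSpace Q]
    [DiscreteTopology Q] [Finite Q] (τ : DiscreteGaloisModule K Q) (h2 : ∀ q : Q, 2 • q = 0 → q = 0) :
    Subsingleton (galoisCohomology τ 3) := by
  classical
  haveI : CompactSpace (absoluteGaloisGroup K) := absoluteGaloisGroup_compactSpace K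
  suffices key : ∀ (n : ℕ) (Q : Type) [AddCommGroup Q] [TopologicalSpace Q] [DiscreteTopology Q] [Finite Q]
      (τ : DiscreteGaloisModule K Q), (∀ q : Q, 2 • q = 0 → q = 0) → Nat.card Q = n →
      Subsingleton (continuousCohomology 3 τ.toTopRep) from key _ Q τ h2 rfl
  intro n
  induction n using Nat.strong_induction_on with
  | _ n ih =>
    intro Q _ _ _ _ τ h2 hn
    by_cases hsub : Subsingleton Q
    · exact subsingleton_continuousCohomology_of_subsingleton τ.toTopRep 2
    · haveI : Nontrivial Q := not_subsingleton_iff_nontrivial.1 hsub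
      obtain ⟨q₀, hq₀⟩ := exists_ne (0 : Q)
      -- an odd prime `p` dividing the order of `q₀`
      have ho1 : 1 < addOrderOf q₀ := by
        have hpos := addOrderOf_pos q₀
        have hne : addOrderOf q₀ ≠ 1 := fun h => hq₀ (AddMonoid.addOrderOf_eq_one_iff.1 h)
        omega
      set p := (addOrderOf q₀).minFac with hp
      haveI hpp : Fact p.Prime := ⟨Nat.minFac_prime ho1.ne'⟩
      have hpdvd : p ∣ addOrderOf q₀ := Nat.minFac_dvd _
      have hp2 : p ≠ 2 := by
        intro h
        have hodd := odd_addOrderOf_of_forall_two_nsmul h2 q₀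
        exact (Nat.not_even_iff_odd.2 hodd) (even_iff_two_dvd.2 (h ▸ hpdvd))
      -- the `p`-primary part `W = Q[p^n]`
      let W : Submodule ℤ Q := Submodule.torsionBy ℤ Q ((p : ℤ) ^ n)
      have hW : ∀ g, W ≤ W.comap (τ g) := torsionBy_le_comap τ _
      have hSES := isSES_subtype_mkQ τ W hW
      have hWp : IsPrimaryTorsion p W := fun w => ⟨n, by
        have hw := w.2
        rw [Submodule.mem_torsionBy_iff] at hw
        apply Subtype.ext
        change p ^ n • (w : Q) = 0
        rw [← natCast_zsmul, Nat.cast_pow]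
        exact hw⟩
      -- `H³(W) = 0` by `cd_p(Γ_K) ≤ 2`
      have h₁ : Subsingleton (continuousCohomology 3 (τ.subrepresentation W hW).toTopRep) :=
        fieldCdLE_two_of_numberField_holds K p (Or.inl hp2) W (τ.subrepresentation W hW) hWp
          (by norm_num : 2 < 3)
      -- the quotient: smaller, still without `2`-torsion
      haveI : Finite (Q ⧸ W) := Finite.of_surjective _ (Submodule.Quotient.mk_surjective W)
      have hn1 : 1 ≤ n := by rw [← hn]; exact Nat.one_le_iff_ne_zero.2 Nat.card_pos.ne'
      have hWnt : 1 < Nat.card W := by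
        -- `(o/p) • q₀ ∈ W` is non-zero
        obtain ⟨k, hk⟩ := hpdvd
        have hk0 : 0 < k := Nat.pos_of_ne_zero fun h0 => by rw [h0, mul_zero] at hk; exact (addOrderOf_pos q₀).ne' hk
        have hne : k • q₀ ≠ 0 := fun h0 => by
          have := Nat.le_of_dvd hk0 (addOrderOf_dvd_of_nsmul_eq_zero h0)
          have hlt : k < addOrderOf q₀ := by
            rw [hk]; exact (Nat.lt_mul_iff_one_lt_left hk0).2 hpp.out.one_lt
          omega
        have hmem : k • q₀ ∈ W := by
          rw [Submodule.mem_torsionBy_iff]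
          change ((p : ℤ) ^ n) • (k • q₀) = 0
          rw [← Nat.cast_pow, natCast_zsmul, smul_smul]
          have hn' : n = (n - 1) + 1 := by omega
          rw [hn', pow_succ, mul_assoc, ← hk, ← smul_smul, addOrderOf_nsmul_eq_zero, smul_zero]
        rw [Finite.one_lt_card_iff_nontrivial]
        exact ⟨⟨⟨k • q₀, hmem⟩, 0, fun h => hne (congrArg Subtype.val h)⟩⟩
      have hlt : Nat.card (Q ⧸ W) < n := by
        have hmul : Nat.card Q = Nat.card (Q ⧸ W) * Nat.card W :=
          AddSubgroup.card_eq_card_quotient_mul_card_addSubgroup W.toAddSubgroup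
        rw [hn] at hmul
        rw [hmul]
        exact (Nat.lt_mul_iff_one_lt_right Nat.card_pos).2 hWnt
      have h2' : ∀ x : Q ⧸ W, 2 • x = 0 → x = 0 := fun x hx => by
        induction x using Submodule.Quotient.induction_on with
        | _ m =>
          have hmem : 2 • m ∈ W := by
            rw [← Submodule.Quotient.mk_eq_zero, Submodule.Quotient.mk_smul]
            exact hx
          rw [Submodule.Quotient.mk_eq_zero, Submodule.mem_torsionBy_iff]
          rw [Submodule.mem_torsionBy_iff] at hmem
          change ((p : ℤ) ^ n) • (2 • m) = 0 at hmem
          change ((p : ℤ) ^ n) • m = 0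
          rw [← Nat.cast_pow, natCast_zsmul] at hmem ⊢
          -- `ord m ∣ 2 p^n` and `ord m` odd, so `ord m ∣ p^n`
          have hd : addOrderOf m ∣ 2 * p ^ n := addOrderOf_dvd_of_nsmul_eq_zero (by rw [mul_comm, mul_nsmul', hmem])
          have hodd := odd_addOrderOf_of_forall_two_nsmul h2 m
          have hd' : addOrderOf m ∣ p ^ n := (Nat.Coprime.dvd_of_dvd_mul_left (Nat.coprime_two_right.2 hodd) hd)
          exact addOrderOf_dvd_iff_nsmul_eq_zero.1 hd'
      have h₃ : Subsingleton (continuousCohomology 3 (τ.quotient W hW).toTopRep) :=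
        ih _ hlt (Q ⧸ W) (τ.quotient W hW) h2' rfl
      exact hSES.subsingleton_X₂ 2 h₁ h₃

end OddPart

/-! ## §2 The `2`-primary case, from the odd-degree `2`-Sylow splitting field, the base case and Cor. 4.16 -/

section TwoPrimary

/-- **Real-place injectivity of `H³(K, M)` for finite `2`-primary `M`**, granted: (hSyl) odd-degree `2`-Sylow
splitting fields over `K`; (hbase) the base case at the trivial module of order `2` over every number field; (h416)
Milne I Cor. 4.16 over every number field.  Proof: descend to `F` (B2 `realThree_injective_of_odd_extension`), where
`Γ_F` acts through the `2`-group `Γ_F/N₀` (B3 `realThree_injective_of_pGroup_quotient`).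
[cite: MilneADT2006, Ch. I, Thm. 4.10 (c) and Cor. 4.16] [cite: SerreGaloisCohomology1997, I §3.3] -/
theorem realThree_injective_of_isPrimaryTorsion_two
    (hSyl : ∀ U : Subgroup (absoluteGaloisGroup K), U.Normal → IsOpen (U : Set (absoluteGaloisGroup K)) →
      ∃ (F : Type) (_ : Field F) (_ : NumberField F) (_ : Algebra K F) (_ : FiniteDimensional K F)
        (N₀ : Subgroup (absoluteGaloisGroup F)) (_ : N₀.Normal) (_ : Finite (absoluteGaloisGroup F ⧸ N₀)),
        Odd (Module.finrank K F) ∧ IsPGroup 2 (absoluteGaloisGroup F ⧸ N₀) ∧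
          N₀ ≤ U.comap (absGaloisRestrict K F : absoluteGaloisGroup F →* absoluteGaloisGroup K))
    (hbase : ∀ (F : Type) [Field F] [NumberField F] (T : Type) [AddCommGroup T] [TopologicalSpace T]
      [DiscreteTopology T] [Finite T] (σ : DiscreteGaloisModule F T),
      (∀ (g : absoluteGaloisGroup F) (t : T), σ g t = t) → Nat.card T = 2 →
        ∀ c : galoisCohomology σ 3,
          (∀ w : InfinitePlace F, w.IsReal → galoisCohomology.localization σ (Sum.inl w) 3 c = 0) → c = 0)
    (h416 : ∀ (F : Type) [Field F] [NumberField F], poitouTate_two_realPlaces_surjective F)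
    (M : Type) [AddCommGroup M] [TopologicalSpace M] [DiscreteTopology M] [Finite M]
    (ρ : DiscreteGaloisModule K M) (hM : IsPrimaryTorsion 2 M) :
    ∀ c : galoisCohomology ρ 3,
      (∀ w : InfinitePlace K, w.IsReal → galoisCohomology.localization ρ (Sum.inl w) 3 c = 0) → c = 0 := by
  classical
  -- the kernel `U` of the action: open, normal, acting trivially
  let U : Subgroup (absoluteGaloisGroup K) := (ρ : absoluteGaloisGroup K →* (M →ₗ[ℤ] M)).ker
  haveI : U.Normal := MonoidHom.normal_ker _
  have hUmem : ∀ g, g ∈ U ↔ ∀ m : M, ρ g m = m := fun g => by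
    rw [MonoidHom.mem_ker]
    constructor
    · intro h m
      have := LinearMap.congr_fun h m
      exact this
    · intro h
      exact LinearMap.ext h
  have hUopen : IsOpen (U : Set (absoluteGaloisGroup K)) := by
    have : (U : Set (absoluteGaloisGroup K)) = ⋂ m : M, {g | ρ g m = m} := by
      ext g
      simp only [SetLike.mem_coe, Set.mem_iInter, Set.mem_setOf_eq]
      exact hUmem g
    rw [this]
    exact isOpen_iInter_of_finite fun m => ρ.isOpen_setOf_apply_eq m
  obtain ⟨F, _, _, _, _, N₀, _, _, hodd, hQ, hN₀U⟩ := hSyl U inferInstance hUopen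
  -- a uniform exponent: `2 ^ r` kills `M`
  obtain ⟨r, hr⟩ := exists_card_eq_prime_pow M hM
  have hMr : ∀ m : M, (2 ^ r) • m = 0 := fun m => by
    haveI := Fintype.ofFinite M
    rw [← hr, Nat.card_eq_fintype_card]
    exact card_nsmul_eq_zero
  -- over `F`: `N₀` acts trivially, `Γ_F/N₀` is a `2`-group
  have hN₀ : ∀ g ∈ N₀, ∀ b : M, (ρ.restrictField F) g b = b := fun g hg b => by
    have hg' := hN₀U hg
    rw [Subgroup.mem_comap] at hg'
    exact ((hUmem _).1 hg') b
  have hF := realThree_injective_of_pGroup_quotient (F := F) N₀ hQ (hbase F) (h416 F) M (ρ.restrictField F)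
    hM hN₀
  exact realThree_injective_of_odd_extension ρ F hodd hMr hF

end TwoPrimary

/-! ## §3 The named fact from the dévissage -/

section Assembly

/-- **Milne I Thm. 4.10 (c)₃ — the named fact `poitouTate_three_realPlaces_injective K` — from the dévissage**:
granted (hSyl) odd-degree `2`-Sylow splitting fields over `K` (Galois theory), (hbase) real-place injectivity of
`H³(F, T)` for trivial `T` of order `2` over every number field `F` (the CFT base case), and (h416) Milne I Cor. 4.16
over every number field, every class of `H³(K, M)` (`M` finite discrete) vanishing at all real places is `0`:
along `0 → M[2^N] → M → M/M[2^N] → 0`, §2 at the kernel, §1 (`H³ = 0`) at the quotient, B1's extension step.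
[cite: MilneADT2006, Ch. I, Thm. 4.10 (c) and Cor. 4.16] [cite: SerreGaloisCohomology1997, II §4.4 Prop. 13] -/
theorem poitouTate_three_realPlaces_injective_of_devissage
    (hSyl : ∀ U : Subgroup (absoluteGaloisGroup K), U.Normal → IsOpen (U : Set (absoluteGaloisGroup K)) →
      ∃ (F : Type) (_ : Field F) (_ : NumberField F) (_ : Algebra K F) (_ : FiniteDimensional K F)
        (N₀ : Subgroup (absoluteGaloisGroup F)) (_ : N₀.Normal) (_ : Finite (absoluteGaloisGroup F ⧸ N₀)),
        Odd (Module.finrank K F) ∧ IsPGroup 2 (absoluteGaloisGroup F ⧸ N₀) ∧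
          N₀ ≤ U.comap (absGaloisRestrict K F : absoluteGaloisGroup F →* absoluteGaloisGroup K))
    (hbase : ∀ (F : Type) [Field F] [NumberField F] (T : Type) [AddCommGroup T] [TopologicalSpace T]
      [DiscreteTopology T] [Finite T] (σ : DiscreteGaloisModule F T),
      (∀ (g : absoluteGaloisGroup F) (t : T), σ g t = t) → Nat.card T = 2 →
        ∀ c : galoisCohomology σ 3,
          (∀ w : InfinitePlace F, w.IsReal → galoisCohomology.localization σ (Sum.inl w) 3 c = 0) → c = 0)
    (h416 : ∀ (F : Type) [Field F] [NumberField F], poitouTate_two_realPlaces_surjective F) :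
    poitouTate_three_realPlaces_injective K := by
  classical
  intro M _ _ _ _ ρ c hc
  haveI : CompactSpace (absoluteGaloisGroup K) := absoluteGaloisGroup_compactSpace K
  -- the `2`-primary part `W = M[2^N]`, `N = #M`
  set N := Nat.card M with hN
  let W : Submodule ℤ M := Submodule.torsionBy ℤ M ((2 : ℤ) ^ N)
  have hW : ∀ g, W ≤ W.comap (ρ g) := torsionBy_le_comap ρ _
  have hSES := isSES_subtype_mkQ ρ W hW
  haveI : Finite W := Subtype.finite
  haveI : Finite (M ⧸ W) := Finite.of_surjective _ (Submodule.Quotient.mk_surjective W)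
  have e2 : ((2 : ℤ) ^ N) = ((2 ^ N : ℕ) : ℤ) := by norm_cast
  have hW2 : IsPrimaryTorsion 2 W := fun w => ⟨N, by
    have hw := w.2
    rw [Submodule.mem_torsionBy_iff, e2, natCast_zsmul] at hw
    exact Subtype.ext hw⟩
  -- the quotient has no `2`-torsion
  have hQ2 : ∀ x : M ⧸ W, 2 • x = 0 → x = 0 := fun x hx => by
    induction x using Submodule.Quotient.induction_on with
    | _ m =>
      have hmem : 2 • m ∈ W := by
        rw [← Submodule.Quotient.mk_eq_zero, Submodule.Quotient.mk_smul]
        exact hx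
      rw [Submodule.Quotient.mk_eq_zero, Submodule.mem_torsionBy_iff, e2, natCast_zsmul]
      rw [Submodule.mem_torsionBy_iff, e2, natCast_zsmul] at hmem
      -- hmem : 2 ^ N • 2 • m = 0
      have h2N : (2 ^ (N + 1)) • m = 0 := by
        rw [pow_succ, ← smul_smul]
        exact hmem
      -- `ord m` is a power of `2` at most `#M = N < 2^N`, so it divides `2^N`
      have hdvd : addOrderOf m ∣ 2 ^ (N + 1) := addOrderOf_dvd_of_nsmul_eq_zero h2N
      obtain ⟨j, _, hj⟩ := (Nat.dvd_prime_pow Nat.prime_two).1 hdvd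
      have hle : addOrderOf m ≤ N := by
        rw [hN]
        haveI := Fintype.ofFinite M
        rw [Nat.card_eq_fintype_card]
        exact addOrderOf_le_card_univ
      have hjN : j ≤ N := by
        have h2j : 2 ^ j ≤ N := hj ▸ hle
        exact (lt_of_lt_of_le (Nat.lt_two_pow_self) h2j).le
      have hdvd' : addOrderOf m ∣ 2 ^ N := hj ▸ Nat.pow_dvd_pow 2 hjN
      exact addOrderOf_dvd_iff_nsmul_eq_zero.1 hdvd'
  -- §2 at the kernel, §1 at the quotient, Cor. 4.16 at the quotient; B1's extension step
  have h1 := realThree_injective_of_isPrimaryTorsion_two hSyl hbase h416 W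
    (show DiscreteGaloisModule K W from ρ.subrepresentation W hW) hW2
  have h3 : ∀ y : galoisCohomology (show DiscreteGaloisModule K (M ⧸ W) from ρ.quotient W hW) 3,
      (∀ w : InfinitePlace K, w.IsReal →
        galoisCohomology.localization (show DiscreteGaloisModule K (M ⧸ W) from ρ.quotient W hW)
          (Sum.inl w) 3 y = 0) → y = 0 := fun y _ =>
    (subsingleton_three_of_forall_two_nsmul (M ⧸ W) (ρ.quotient W hW) hQ2).elim _ _
  have h2 := h416 K (M ⧸ W) (ρ.quotient W hW)
  exact IsSES.eq_zero_of_forall_localization_inl_three hSES h1 h3 h2 c hc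

end Assembly

end Literature.NumberTheory.GaloisCohomology.PoitouTateFinite.SignedEC.ShaThree

end Part4

/-!
## Part 5 — port of `Summits/BirchSwinnertonDyer/BirchSwinnertonDyer/Theorems/ThetaPartnerAtTwoSignedControlAtTwoShaThreeSylowField.lean` (3 declarations kept)

# The odd-degree `2`-Sylow splitting field, and Milne I Thm. 4.10 (c)₃ from the order-`2` base case alone (K4 `SignedControlAtTwo` stub 3 `stub_poitouTateThreeRealRat`)

Declarations of this Part (verbatim port; each keeps its own docstring and citation): `galFixing_le_range_absGaloisRestrict`, `exists_oddDegree_twoSylow_splittingField`, `poitouTate_three_realPlaces_injective_of_base`.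

Reference keys (see `references.bib` and the declarations' citations): [MilneADT2006], [SerreGaloisCohomology1997], [NeukirchANT1999].
-/

section Part5

set_option autoImplicit false
open _root_.CategoryTheory _root_.NumberField _root_.Field _root_.Function _root_.IntermediateField
open _root_.TopRep _root_.ContRepresentation _root_.ContinuousCohomology
open Literature.NumberTheory.GaloisRepresentations
open Literature.NumberTheory.GaloisRepresentations.LocalWeilDatum
open Literature.NumberTheory.GaloisCohomology

namespace Literature.NumberTheory.GaloisCohomology.PoitouTateFinite.SignedEC.ShaThree

/-! ## §1 The odd-degree `2`-Sylow splitting field -/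

section Sylow

variable (K : Type) [Field K] [NumberField K]

omit [NumberField K] in
/-- **`Gal(K̄/L₁) ≤ res(Γ_F)` for a subfield `F ⊆ L₁` of a finite NORMAL `L₁ ⊆ K̄`**: the embedded copy `e(F)` of the
abstract field `F` (tree `absEmbedding`) lies in `L₁` (its elements are `K`-conjugates of elements of `L₁`), so
everything fixing `L₁` fixes `e(F)` (`mem_range_absGaloisRestrict_iff_smul_absEmbedding`). [cite: NeukirchANT1999, Ch. IV §1] -/
theorem galFixing_le_range_absGaloisRestrict (L₁ : IntermediateField K (AlgebraicClosure K))
    [FiniteDimensional K L₁] [Normal K L₁] (F₀ : IntermediateField K L₁) :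
    galFixing K L₁ ≤ (absGaloisRestrict K (lift F₀)).range := by
  intro g hg
  haveI : FiniteDimensional K (lift F₀) := (liftAlgEquiv F₀).toLinearEquiv.finiteDimensional
  haveI : Algebra.IsAlgebraic K (lift F₀) := Algebra.IsAlgebraic.of_finite K _
  rw [mem_range_absGaloisRestrict_iff_smul_absEmbedding]
  intro x
  -- `e x ∈ L₁`
  have hmem : absEmbedding K (lift F₀) x ∈ L₁ := by
    have hint : IsIntegral K (absEmbedding K (lift F₀) x) := Algebra.IsIntegral.isIntegral _
    refine hint.mem_intermediateField_of_minpoly_splits ?_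
    have hxL : ((x : lift F₀) : AlgebraicClosure K) ∈ L₁ := lift_le F₀ x.2
    have h1 : minpoly K (absEmbedding K (lift F₀) x) = minpoly K x :=
      minpoly.algHom_eq _ (absEmbedding K (lift F₀)).injective x
    have h2 : minpoly K x = minpoly K ((x : lift F₀) : AlgebraicClosure K) :=
      (minpoly.algHom_eq (lift F₀).val Subtype.val_injective x).symm
    have h3 : minpoly K (⟨(x : AlgebraicClosure K), hxL⟩ : L₁) = minpoly K ((x : lift F₀) : AlgebraicClosure K) :=
      (minpoly.algHom_eq L₁.val Subtype.val_injective ⟨(x : AlgebraicClosure K), hxL⟩).symm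
    rw [h1, h2, ← h3]
    exact Normal.splits inferInstance _
  exact (mem_galFixing_iff K).1 hg _ hmem

/-- **The odd-degree `2`-Sylow splitting field.**  For a number field `K` and an open normal subgroup `U ⊴ Γ_K`
there are a finite extension `F/K` of odd degree and a normal subgroup `N₀ ⊴ Γ_F` of finite `2`-power index whose
image under `res : Γ_F → Γ_K` lies in `U` (`F` = fixed field of a `2`-Sylow subgroup of `Gal(L₁/K)` for a finite Galois
`L₁` with `Gal(K̄/L₁) ≤ U`; `N₀ = res⁻¹ Gal(K̄/L₁)`).  This is hypothesis (hSyl) of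
`poitouTate_three_realPlaces_injective_of_devissage`. [cite: SerreGaloisCohomology1997, I §3.3] [cite: NeukirchANT1999, Ch. IV §1] -/
theorem exists_oddDegree_twoSylow_splittingField (U : Subgroup (absoluteGaloisGroup K)) [U.Normal]
    (hU : IsOpen (U : Set (absoluteGaloisGroup K))) :
    ∃ (F : Type) (_ : Field F) (_ : NumberField F) (_ : Algebra K F) (_ : FiniteDimensional K F)
      (N₀ : Subgroup (absoluteGaloisGroup F)) (_ : N₀.Normal) (_ : Finite (absoluteGaloisGroup F ⧸ N₀)),
      Odd (Module.finrank K F) ∧ IsPGroup 2 (absoluteGaloisGroup F ⧸ N₀) ∧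
        N₀ ≤ U.comap (absGaloisRestrict K F : absoluteGaloisGroup F →* absoluteGaloisGroup K) := by
  classical
  haveI : CompactSpace (absoluteGaloisGroup K) := absoluteGaloisGroup_compactSpace K
  obtain ⟨L₁, hfin, hgal, hL₁U⟩ := exists_finiteDimensional_isGalois_galFixing_subset (hU.mem_nhds U.one_mem)
  haveI := hfin
  haveI := hgal
  -- a `2`-Sylow subgroup `P` of `A = Gal(L₁/K)` and its fixed field
  obtain ⟨P⟩ : Nonempty (Sylow 2 (L₁ ≃ₐ[K] L₁)) := inferInstance
  let F₀ : IntermediateField K L₁ := fixedField (P : Subgroup (L₁ ≃ₐ[K] L₁))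
  let F : IntermediateField K (AlgebraicClosure K) := lift F₀
  haveI : FiniteDimensional K F := (liftAlgEquiv F₀).toLinearEquiv.finiteDimensional
  haveI : NumberField F := NumberField.of_module_finite K F
  -- degree `[F : K] = [A : P]`, odd
  have hcardA : Nat.card (L₁ ≃ₐ[K] L₁) = Module.finrank K L₁ := IsGalois.card_aut_eq_finrank K L₁
  have hdeg0 : Module.finrank K F₀ = (P : Subgroup (L₁ ≃ₐ[K] L₁)).index := by
    have htower := Module.finrank_mul_finrank K F₀ L₁
    rw [finrank_fixedField_eq_card, ← hcardA, ← (P : Subgroup (L₁ ≃ₐ[K] L₁)).index_mul_card] at htower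
    exact Nat.eq_of_mul_eq_mul_right Nat.card_pos htower
  have hdeg : Module.finrank K F = (P : Subgroup (L₁ ≃ₐ[K] L₁)).index := by
    rw [← hdeg0]
    exact (liftAlgEquiv F₀).symm.toLinearEquiv.finrank_eq
  have hodd : Odd (Module.finrank K F) := by
    rw [hdeg, ← Nat.coprime_two_right]
    exact (Nat.coprime_comm).1 ((Nat.Prime.coprime_iff_not_dvd Nat.prime_two).2 P.not_dvd_index)
  -- `N₀ = res⁻¹ Gal(K̄/L₁)`
  let N₀ : Subgroup (absoluteGaloisGroup F) := (galFixing K L₁).comap (absGaloisRestrict K F).toMonoidHom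
  haveI hnormal : (galFixing K L₁).Normal := by rw [← ker_resGal L₁]; exact MonoidHom.normal_ker _
  haveI : N₀.Normal := Subgroup.Normal.comap hnormal _
  -- its index is `#P`, a power of `2`
  have hle : galFixing K L₁ ≤ (absGaloisRestrict K F).range := galFixing_le_range_absGaloisRestrict K L₁ F₀
  have hindexU : (galFixing K L₁).index = Nat.card (L₁ ≃ₐ[K] L₁) := by
    rw [← ker_resGal L₁, Subgroup.index_ker, MonoidHom.range_eq_top.2 (resGal_surjective L₁), Subgroup.card_top]
  have hindexR : (absGaloisRestrict K F).range.index = (P : Subgroup (L₁ ≃ₐ[K] L₁)).index := by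
    rw [index_range_absGaloisRestrict, hdeg]
  have hidx0 : (P : Subgroup (L₁ ≃ₐ[K] L₁)).index ≠ 0 := Subgroup.index_ne_zero_of_finite
  have hN₀index : N₀.index = Nat.card (P : Subgroup (L₁ ≃ₐ[K] L₁)) := by
    have h := Subgroup.relIndex_mul_index hle
    rw [hindexU, hindexR, ← (P : Subgroup (L₁ ≃ₐ[K] L₁)).index_mul_card] at h
    -- h : rel * P.index = P.index * #P
    rw [Subgroup.index_comap]
    exact Nat.eq_of_mul_eq_mul_right (Nat.pos_of_ne_zero hidx0) (h.trans (mul_comm _ _))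
  obtain ⟨k, hk⟩ := P.isPGroup'.exists_card_eq
  have hN₀k : N₀.index = 2 ^ k := by rw [hN₀index, hk]
  haveI : N₀.FiniteIndex := ⟨by rw [hN₀k]; exact pow_ne_zero _ two_ne_zero⟩
  haveI : Finite (absoluteGaloisGroup F ⧸ N₀) := Subgroup.finite_quotient_of_finiteIndex
  have hQ : IsPGroup 2 (absoluteGaloisGroup F ⧸ N₀) :=
    IsPGroup.of_card (by rw [← Subgroup.index_eq_card, hN₀k] : Nat.card (absoluteGaloisGroup F ⧸ N₀) = 2 ^ k)
  refine ⟨F, inferInstance, inferInstance, inferInstance, inferInstance, N₀, inferInstance, inferInstance, hodd, hQ,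
    ?_⟩
  exact Subgroup.comap_mono (fun g hg => hL₁U hg)

end Sylow

/-! ## §2 Milne I Thm. 4.10 (c)₃ from the order-`2` base case and Cor. 4.16 -/

section Final

/-- **Milne I Thm. 4.10 (c), `r = 3`, injectivity — `poitouTate_three_realPlaces_injective K` for EVERY number field
`K` — from the base case at the trivial module of order `2` and Milne I Cor. 4.16**: (hbase) for every number field
`F` and every discrete `Γ_F`-module `T` of order `2` with trivial action, a class of `H³(F, T)` vanishing at all real
places of `F` is `0`; (h416) `poitouTate_two_realPlaces_surjective F` for every number field `F`.  (Dévissage: odd part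
by `cd_p ≤ 2`, `2`-part by odd-degree descent to a `2`-Sylow splitting field and filtration by stable lines, the
extension step at each stage.) [cite: MilneADT2006, Ch. I, Thm. 4.10 (c) and Cor. 4.16]
[cite: SerreGaloisCohomology1997, I §3.3 and II §4.4 Prop. 13] -/
theorem poitouTate_three_realPlaces_injective_of_base (K : Type) [Field K] [NumberField K]
    (hbase : ∀ (F : Type) [Field F] [NumberField F] (T : Type) [AddCommGroup T] [TopologicalSpace T]
      [DiscreteTopology T] [Finite T] (σ : DiscreteGaloisModule F T),
      (∀ (g : absoluteGaloisGroup F) (t : T), σ g t = t) → Nat.card T = 2 →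
        ∀ c : galoisCohomology σ 3,
          (∀ w : InfinitePlace F, w.IsReal → galoisCohomology.localization σ (Sum.inl w) 3 c = 0) → c = 0)
    (h416 : ∀ (F : Type) [Field F] [NumberField F], poitouTate_two_realPlaces_surjective F) :
    poitouTate_three_realPlaces_injective K :=
  poitouTate_three_realPlaces_injective_of_devissage
    (fun U hUn hU => by haveI := hUn; exact exists_oddDegree_twoSylow_splittingField K U hU) hbase h416

end Final

end Literature.NumberTheory.GaloisCohomology.PoitouTateFinite.SignedEC.ShaThree

end Part5

/-!
## Part 6 — port of `Summits/BirchSwinnertonDyer/BirchSwinnertonDyer/Theorems/ThetaPartnerAtTwoSignedControlAtTwoShaThreeBaseOfBrauer.lean` (3 declarations kept)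

# The base case of Milne I Thm. 4.10 (c)₃ — `H³(F, ℤ/2) ↪ ⊕_{w real} H³(F_w, ℤ/2)` — from two statements about the Brauer group (K4 `SignedControlAtTwo` stub 3; the (hbase) input of `poitouTate_three_realPlaces_injective_of_base`)

Declarations of this Part (verbatim port; each keeps its own docstring and citation): `realThree_injective_mu_two_of_brauer`, `realThree_injective_orderTwo_of_brauer`, `poitouTate_three_realPlaces_injective_of_brauer`.

Reference keys (see `references.bib` and the declarations' citations): [MilneADT2006], [CasselsFrohlichANT1967], [SerreGaloisCohomology1997].
-/

section Part6

set_option autoImplicit false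
open _root_.CategoryTheory _root_.NumberField _root_.Field _root_.Function
open _root_.TopRep _root_.ContRepresentation _root_.ContinuousCohomology
open Literature.NumberTheory.GaloisRepresentations
open Literature.NumberTheory.GaloisRepresentations.DiscreteGaloisModule (mu MuCarrier units UnitsCarrier)
open Literature.NumberTheory.GaloisCohomology

namespace Literature.NumberTheory.GaloisCohomology.PoitouTateFinite.SignedEC.ShaThree

variable (F : Type) [Field F] [NumberField F]

/-! ## §1 `μ₂`: real-place injectivity of `H³(F, μ₂)` from the Brauer group -/

section MuTwo

/-- **Real-place injectivity of `H³(F, μ₂)` from `H³(F, 𝔾_m)[2] = 0` and the real-place detection of `Br(F)/2`.**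
(hH3): `z + z = 0 → z = 0` on `H³(F, F̄ˣ)`; (hBr): a class of `H²(F, F̄ˣ)` which is twice a class locally at every real place
is twice a class.  Conclusion: a class of `H³(F, μ₂)` vanishing at all real places is `0`.
[cite: MilneADT2006, Ch. I, Thm. 4.10 (c)] [cite: CasselsFrohlichANT1967, Ch. VII §11] [cite: SerreGaloisCohomology1997, II §1.2] -/
theorem realThree_injective_mu_two_of_brauer
    (hH3 : ∀ z : galoisCohomology (units F) 3, z + z = 0 → z = 0)
    (hBr : ∀ u : galoisCohomology (units F) 2,
      (∀ w : InfinitePlace F, w.IsReal → ∃ u' : galoisCohomology ((units F).toLocal (Sum.inl w)) 2,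
        galoisCohomology.localization (units F) (Sum.inl w) 2 u = u' + u') →
      ∃ u'' : galoisCohomology (units F) 2, u = u'' + u'') :
    ∀ c : galoisCohomology (mu F 2) 3,
      (∀ w : InfinitePlace F, w.IsReal → galoisCohomology.localization (mu F 2) (Sum.inl w) 3 c = 0) → c = 0 := by
  classical
  intro c hc
  haveI : CompactSpace (absoluteGaloisGroup F) := absoluteGaloisGroup_compactSpace F
  haveI : ∀ w : InfinitePlace F, CompactSpace (absoluteGaloisGroup (Place.Completion (Sum.inl w : Place F))) :=
    fun w => absoluteGaloisGroup_compactSpace _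
  -- localisation on explicit cocycles (degrees 2 and 3)
  have loc₂ : ∀ {N : Type} [AddCommGroup N] [TopologicalSpace N] [DiscreteTopology N]
      (τ : DiscreteGaloisModule F N) (w : InfinitePlace F) (d : contTwoCocycles τ.toTopRep),
      galoisCohomology.localization τ (Sum.inl w) 2 (twoCocycleClass τ.toTopRep d) =
        twoCocycleClass (DiscreteGaloisModule.toTopRep (τ.toLocal (Sum.inl w)))
          (contTwoCocycles.pullback (absGaloisRestrict F (Place.Completion (Sum.inl w : Place F)))
            (X := τ.toTopRep) (Y := DiscreteGaloisModule.toTopRep (τ.toLocal (Sum.inl w)))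
            (TopRep.ofHom ⟨ContinuousLinearMap.id ℤ N, fun _ => rfl⟩) d) :=
    fun τ w d ↦ map_twoCocycleClass _ _ _ d
  have loc₃ : ∀ {N : Type} [AddCommGroup N] [TopologicalSpace N] [DiscreteTopology N]
      (τ : DiscreteGaloisModule F N) (w : InfinitePlace F) (d : contThreeCocycles τ.toTopRep),
      galoisCohomology.localization τ (Sum.inl w) 3 (threeCocycleClass τ.toTopRep d) =
        threeCocycleClass (DiscreteGaloisModule.toTopRep (τ.toLocal (Sum.inl w)))
          (contThreeCocycles.pullback (absGaloisRestrict F (Place.Completion (Sum.inl w : Place F)))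
            (X := τ.toTopRep) (Y := DiscreteGaloisModule.toTopRep (τ.toLocal (Sum.inl w)))
            (TopRep.ofHom ⟨ContinuousLinearMap.id ℤ N, fun _ => rfl⟩) d) :=
    fun τ w d ↦ map_threeCocycleClass _ _ _ d
  set Γ := absoluteGaloisGroup F with hΓ
  let Γl : InfinitePlace F → Type := fun w => absoluteGaloisGroup (Place.Completion (Sum.inl w : Place F))
  let r : ∀ w : InfinitePlace F, Γl w →ₜ* Γ := fun w => absGaloisRestrict F (Place.Completion (Sum.inl w : Place F))
  -- the Kummer sequence `0 → μ₂ →ι F̄ˣ →π F̄ˣ → 0`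
  set ι := kummerι F 2 with hι
  set π := kummerπ F 2 with hπ
  have h : IsSES ι π := isSES_kummer F 2 two_pos
  have hπx : ∀ x : UnitsCarrier F, π.hom x = x + x := fun x => by
    rw [hπ, kummerπ_hom_apply, Nat.cast_ofNat, two_zsmul]
  let ιC : C(MuCarrier F 2, UnitsCarrier F) := ⟨ι.hom, ι.hom.continuous⟩
  let πC : C(UnitsCarrier F, UnitsCarrier F) := ⟨π.hom, π.hom.continuous⟩
  have hπd : ∀ (b : C(Γ × Γ, UnitsCarrier F)) (σ τ υ : Γ), π.hom (dTwo (units F).toTopRep b σ τ υ) =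
      dTwo (units F).toTopRep (πC.comp b) σ τ υ := fun b σ τ υ => by
    rw [dTwo_apply, dTwo_apply, map_sub, map_add, map_sub, TopRep.hom_comm_apply π σ]
    rfl
  have hιd : ∀ (b : C(Γ × Γ, MuCarrier F 2)) (σ τ υ : Γ), ι.hom (dTwo (mu F 2).toTopRep b σ τ υ) =
      dTwo (units F).toTopRep (ιC.comp b) σ τ υ := fun b σ τ υ => by
    rw [dTwo_apply, dTwo_apply, map_sub, map_add, map_sub, TopRep.hom_comm_apply ι σ]
    rfl
  obtain ⟨a, rfl⟩ := threeCocycleClass_surjective _ c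
  -- every element of `μ₂` is killed by `2`
  have haa : ∀ p, a.1 p + a.1 p = 0 := fun p => by
    have h2 := zsmul_muCarrier_eq_zero F 2 (a.1 p)
    rw [Nat.cast_ofNat, two_zsmul] at h2
    exact h2
  /- Step 1: `ι_* [a]` is `2`-torsion, hence `0` by (hH3): `ι ∘ a = dγ`. -/
  let ιa : contThreeCocycles (units F).toTopRep :=
    contThreeCocycles.pullback (ContinuousMonoidHom.id Γ) (resIdHom ι) a
  have hιa : ∀ σ τ υ, ιa.1 (σ, τ, υ) = ι.hom (a.1 (σ, τ, υ)) := fun _ _ _ => rfl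
  have hιa0 : threeCocycleClass (units F).toTopRep ιa = 0 := by
    refine hH3 _ ?_
    have hsum : ιa + ιa = 0 := Subtype.ext (ContinuousMap.ext fun ⟨σ, τ, υ⟩ => by
      change ιa.1 (σ, τ, υ) + ιa.1 (σ, τ, υ) = 0
      rw [hιa, ← map_add, haa, map_zero])
    have h0 : threeCocycleClass (units F).toTopRep (ιa + ιa) = 0 := by rw [hsum, threeCocycleClass_zero]
    rw [threeCocycleClass_add] at h0
    exact h0
  obtain ⟨γ, hγ⟩ : ∃ γ : C(Γ × Γ, UnitsCarrier F), ∀ σ τ υ, ιa.1 (σ, τ, υ) = dTwo (units F).toTopRep γ σ τ υ :=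
    (threeCocycleClass_eq_zero_iff_dTwo _ _).1 hιa0
  have hγ' : ∀ σ τ υ, dTwo (units F).toTopRep γ σ τ υ = ι.hom (a.1 (σ, τ, υ)) := fun σ τ υ => by
    rw [← hιa, hγ]
  -- `ψ := π ∘ γ = 2γ` is a `2`-cocycle; `u := [ψ]`
  have hψ : πC.comp γ ∈ contTwoCocycles (units F).toTopRep :=
    (mem_contTwoCocycles_iff_dTwo _ _).2 fun σ τ υ => by
      rw [← hπd, hγ']
      exact h.g_f_apply _
  let ψ : contTwoCocycles (units F).toTopRep := ⟨_, hψ⟩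
  have hψapply : ∀ σ τ, ψ.1 (σ, τ) = π.hom (γ (σ, τ)) := fun _ _ => rfl
  /- Step 2: at a real place `w`, `u|_w` is twice a class. -/
  have hloc : ∀ w : InfinitePlace F, w.IsReal →
      ∃ u' : galoisCohomology ((units F).toLocal (Sum.inl w)) 2,
        galoisCohomology.localization (units F) (Sum.inl w) 2 (twoCocycleClass _ ψ) = u' + u' := by
    intro w hw
    have hcw := hc w hw
    rw [loc₃] at hcw
    obtain ⟨κ, hκ⟩ : ∃ κ : C(Γl w × Γl w, MuCarrier F 2), ∀ σ τ υ,
        (contThreeCocycles.pullback (r w) (X := (mu F 2).toTopRep)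
          (Y := DiscreteGaloisModule.toTopRep ((mu F 2).toLocal (Sum.inl w)))
          (TopRep.ofHom ⟨ContinuousLinearMap.id ℤ (MuCarrier F 2), fun _ => rfl⟩) a).1 (σ, τ, υ) =
        dTwo (DiscreteGaloisModule.toTopRep ((mu F 2).toLocal (Sum.inl w))) κ σ τ υ :=
      (threeCocycleClass_eq_zero_iff_dTwo _ _).1 hcw
    have hκ' : ∀ σ τ υ, a.1 (r w σ, r w τ, r w υ) =
        dTwo (DiscreteGaloisModule.toTopRep ((mu F 2).toLocal (Sum.inl w))) κ σ τ υ := fun σ τ υ => hκ σ τ υ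
    -- the local `2`-cocycle `γ|_w - ι ∘ κ`
    let γw : C(Γl w × Γl w, UnitsCarrier F) := γ.comp ((r w : C(Γl w, Γ)).prodMap (r w : C(Γl w, Γ)))
    let φw : C(Γl w × Γl w, UnitsCarrier F) := γw - ιC.comp κ
    have hφw_apply : ∀ σ τ, φw (σ, τ) = γ (r w σ, r w τ) - ι.hom (κ (σ, τ)) := fun _ _ => rfl
    have hιdl : ∀ σ τ υ, ι.hom (dTwo (DiscreteGaloisModule.toTopRep ((mu F 2).toLocal (Sum.inl w))) κ σ τ υ) =
        dTwo (DiscreteGaloisModule.toTopRep ((units F).toLocal (Sum.inl w))) (ιC.comp κ) σ τ υ := fun σ τ υ => by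
      rw [dTwo_apply, dTwo_apply, map_sub, map_add, map_sub]
      change ι.hom ((mu F 2) (r w σ) (κ (τ, υ))) - _ + _ - _ = (units F) (r w σ) (ι.hom (κ (τ, υ))) - _ + _ - _
      rw [ContinuousRep.hom_comm_apply ι (r w σ)]
      rfl
    have hγl : ∀ σ τ υ, dTwo (DiscreteGaloisModule.toTopRep ((units F).toLocal (Sum.inl w))) γw σ τ υ =
          dTwo (units F).toTopRep γ (r w σ) (r w τ) (r w υ) := fun σ τ υ => by
      rw [dTwo_apply, dTwo_apply]
      change (units F) (r w σ) (γ (r w τ, r w υ)) - γ (r w (σ * τ), r w υ) + γ (r w σ, r w (τ * υ)) -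
        γ (r w σ, r w τ) = _
      rw [map_mul, map_mul]
      rfl
    have hφw : φw ∈ contTwoCocycles (DiscreteGaloisModule.toTopRep ((units F).toLocal (Sum.inl w))) :=
      (mem_contTwoCocycles_iff_dTwo _ _).2 fun σ τ υ => by
        change dTwo (DiscreteGaloisModule.toTopRep ((units F).toLocal (Sum.inl w))) (γw - ιC.comp κ) σ τ υ = 0
        rw [dTwo_sub, hγl, hγ', ← hιdl, ← hκ', sub_self]
    refine ⟨twoCocycleClass _ ⟨φw, hφw⟩, ?_⟩
    have h1 : galoisCohomology.localization (units F) (Sum.inl w) 2 (twoCocycleClass _ ψ) =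
        twoCocycleClass (DiscreteGaloisModule.toTopRep ((units F).toLocal (Sum.inl w)))
          (⟨φw, hφw⟩ + ⟨φw, hφw⟩) := by
      rw [loc₂]
      refine congrArg _ (Subtype.ext (ContinuousMap.ext fun ⟨σ, τ⟩ => ?_))
      change ψ.1 (r w σ, r w τ) = φw (σ, τ) + φw (σ, τ)
      rw [hψapply, hφw_apply, ← hπx, map_sub, h.g_f_apply, sub_zero]
    rw [twoCocycleClass_add] at h1
    exact h1
  /- Step 3: (hBr) gives `u = [φ] + [φ]`; then `γ - φ - dθ̃ = ι ∘ b` and `a = db`. -/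
  obtain ⟨u'', hu''⟩ := hBr (twoCocycleClass _ ψ) hloc
  obtain ⟨φ, rfl⟩ := twoCocycleClass_surjective _ u''
  have hu3 : (twoCocycleClass (units F).toTopRep ψ : continuousCohomology 2 (units F).toTopRep) =
      twoCocycleClass (units F).toTopRep φ + twoCocycleClass (units F).toTopRep φ := hu''
  have hdiff : twoCocycleClass (units F).toTopRep (ψ - (φ + φ)) = 0 := by
    rw [twoCocycleClass_sub, twoCocycleClass_add, hu3, sub_self]
  obtain ⟨θ, hθ⟩ := (twoCocycleClass_eq_zero_iff _ _).1 hdiff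
  have hθ' : ∀ σ τ, π.hom (γ (σ, τ)) - (φ.1 (σ, τ) + φ.1 (σ, τ)) =
      (units F) σ (θ τ) - θ (σ * τ) + θ σ := fun σ τ => hθ σ τ
  let θt : C(Γ, UnitsCarrier F) := ⟨h.lift ∘ θ, (continuous_of_discreteTopology (f := h.lift)).comp θ.continuous⟩
  have hθt : ∀ σ, π.hom (θt σ) = θ σ := fun σ => h.g_lift _
  let γ' : C(Γ × Γ, UnitsCarrier F) := γ - φ.1 - ((units F).twoCoboundary θt : contTwoCocycles _).1
  have hγ'apply : ∀ σ τ, γ' (σ, τ) = γ (σ, τ) - φ.1 (σ, τ) - ((units F) σ (θt τ) - θt (σ * τ) + θt σ) :=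
    fun _ _ => rfl
  have hγ'π : ∀ p, π.hom (γ' p) = 0 := fun ⟨σ, τ⟩ => by
    rw [hγ'apply, map_sub, map_sub, map_add, map_sub, ContinuousRep.hom_comm_apply π σ, hθt, hθt, hθt, ← hθ',
      hπx (φ.1 _)]
    abel
  let b : C(Γ × Γ, MuCarrier F 2) := ⟨h.inv ∘ γ', (continuous_of_discreteTopology (f := h.inv)).comp γ'.continuous⟩
  have hιb : ∀ p, ι.hom (b p) = γ' p := fun p => h.f_inv (hγ'π p)
  have hab : ∀ σ τ υ, a.1 (σ, τ, υ) = dTwo (mu F 2).toTopRep b σ τ υ := fun σ τ υ => by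
    apply h.injective
    rw [← hγ', hιd]
    have hιbC : ιC.comp b = γ' := ContinuousMap.ext fun p => hιb p
    rw [hιbC]
    change dTwo (units F).toTopRep γ σ τ υ =
      dTwo (units F).toTopRep (γ - φ.1 - ((units F).twoCoboundary θt : contTwoCocycles _).1) σ τ υ
    rw [dTwo_sub, dTwo_sub, dTwo_coe_contTwoCocycles, dTwo_coe_contTwoCocycles, sub_zero, sub_zero]
  exact (threeCocycleClass_eq_zero_iff_dTwo _ _).2 ⟨b, hab⟩

end MuTwo

/-! ## §2 Every trivial module of order `2` -/

section OrderTwo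

/-- **The (hbase) input of `poitouTate_three_realPlaces_injective_of_base` AT `F`, from the Brauer-group statements**:
for every discrete `Γ_F`-module `T` of order `2` with trivial action, a class of `H³(F, T)` vanishing at all real places is
`0` — transport of §1 along the (equivariant, both actions being trivial) isomorphism `T ≅ μ₂(F̄)`.
[cite: MilneADT2006, Ch. I, Thm. 4.10 (c)] [cite: CasselsFrohlichANT1967, Ch. VII §11] -/
theorem realThree_injective_orderTwo_of_brauer
    (hH3 : ∀ z : galoisCohomology (units F) 3, z + z = 0 → z = 0)
    (hBr : ∀ u : galoisCohomology (units F) 2,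
      (∀ w : InfinitePlace F, w.IsReal → ∃ u' : galoisCohomology ((units F).toLocal (Sum.inl w)) 2,
        galoisCohomology.localization (units F) (Sum.inl w) 2 u = u' + u') →
      ∃ u'' : galoisCohomology (units F) 2, u = u'' + u'')
    (T : Type) [AddCommGroup T] [TopologicalSpace T] [DiscreteTopology T] [Finite T]
    (σT : DiscreteGaloisModule F T) (htriv : ∀ (g : absoluteGaloisGroup F) (t : T), σT g t = t)
    (hcard : Nat.card T = 2) :
    ∀ c : galoisCohomology σT 3,
      (∀ w : InfinitePlace F, w.IsReal → galoisCohomology.localization σT (Sum.inl w) 3 c = 0) → c = 0 := by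
  classical
  intro c hc
  haveI : CompactSpace (absoluteGaloisGroup F) := absoluteGaloisGroup_compactSpace F
  haveI : ∀ w : InfinitePlace F, CompactSpace (absoluteGaloisGroup (Place.Completion (Sum.inl w : Place F))) :=
    fun w => absoluteGaloisGroup_compactSpace _
  have loc₃ : ∀ {N : Type} [AddCommGroup N] [TopologicalSpace N] [DiscreteTopology N]
      (τ : DiscreteGaloisModule F N) (w : InfinitePlace F) (d : contThreeCocycles τ.toTopRep),
      galoisCohomology.localization τ (Sum.inl w) 3 (threeCocycleClass τ.toTopRep d) =
        threeCocycleClass (DiscreteGaloisModule.toTopRep (τ.toLocal (Sum.inl w)))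
          (contThreeCocycles.pullback (absGaloisRestrict F (Place.Completion (Sum.inl w : Place F)))
            (X := τ.toTopRep) (Y := DiscreteGaloisModule.toTopRep (τ.toLocal (Sum.inl w)))
            (TopRep.ofHom ⟨ContinuousLinearMap.id ℤ N, fun _ => rfl⟩) d) :=
    fun τ w d ↦ map_threeCocycleClass _ _ _ d
  set Γ := absoluteGaloisGroup F with hΓ
  let Γl : InfinitePlace F → Type := fun w => absoluteGaloisGroup (Place.Completion (Sum.inl w : Place F))
  let r : ∀ w : InfinitePlace F, Γl w →ₜ* Γ := fun w => absGaloisRestrict F (Place.Completion (Sum.inl w : Place F))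
  -- the additive isomorphism `T ≃ μ₂(F̄)` (both cyclic of order `2`), equivariant since both actions are trivial
  have hcycT : IsAddCyclic T := isAddCyclic_of_prime_card hcard
  let e : T ≃+ MuCarrier F 2 :=
    (zmodAddCyclicAddEquiv hcycT).symm.trans
      ((ZMod.ringEquivCongr hcard).toAddEquiv.trans (muCarrierZModEquiv F 2).symm)
  have hmu : ∀ (g : Γ) (v : MuCarrier F 2), mu F 2 g v = v := WeierstrassCurve.mu_two_apply_eq
  obtain ⟨z, rfl⟩ := threeCocycleClass_surjective _ c
  -- `e ∘ z`, a `3`-cocycle of `μ₂`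
  let eC : C(T, MuCarrier F 2) := ⟨e, continuous_of_discreteTopology⟩
  let ez : contThreeCocycles (mu F 2).toTopRep :=
    ⟨eC.comp z.1, fun σ τ υ ω => by
      have key := z.2 σ τ υ ω
      change σT σ (z.1 (τ, υ, ω)) + z.1 (σ, τ * υ, ω) + z.1 (σ, τ, υ) = z.1 (σ * τ, υ, ω) + z.1 (σ, τ, υ * ω) at key
      change mu F 2 σ (e (z.1 (τ, υ, ω))) + e (z.1 (σ, τ * υ, ω)) + e (z.1 (σ, τ, υ)) =
        e (z.1 (σ * τ, υ, ω)) + e (z.1 (σ, τ, υ * ω))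
      rw [hmu, htriv] at *
      rw [← map_add, ← map_add, key, map_add]⟩
  -- it vanishes at the real places
  have hez : ∀ w : InfinitePlace F, w.IsReal →
      galoisCohomology.localization (mu F 2) (Sum.inl w) 3 (threeCocycleClass _ ez) = 0 := by
    intro w hw
    have hcw := hc w hw
    rw [loc₃] at hcw ⊢
    obtain ⟨κ, hκ⟩ := (threeCocycleClass_eq_zero_iff_dTwo _ _).1 hcw
    refine (threeCocycleClass_eq_zero_iff_dTwo _ _).2 ⟨eC.comp κ, fun σ τ υ => ?_⟩
    have hκ' : z.1 (r w σ, r w τ, r w υ) = dTwo (DiscreteGaloisModule.toTopRep (σT.toLocal (Sum.inl w))) κ σ τ υ :=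
      hκ σ τ υ
    change e (z.1 (r w σ, r w τ, r w υ)) = _
    rw [hκ', dTwo_apply, dTwo_apply]
    change e (σT (r w σ) (κ (τ, υ)) - κ (σ * τ, υ) + κ (σ, τ * υ) - κ (σ, τ)) =
      mu F 2 (r w σ) (e (κ (τ, υ))) - e (κ (σ * τ, υ)) + e (κ (σ, τ * υ)) - e (κ (σ, τ))
    rw [htriv, hmu, map_sub, map_add, map_sub]
  -- §1: `[e ∘ z] = 0`, i.e. `e ∘ z = db`; then `z = d(e⁻¹ ∘ b)`
  have hez0 := realThree_injective_mu_two_of_brauer F hH3 hBr (threeCocycleClass _ ez) hez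
  obtain ⟨b, hb⟩ := (threeCocycleClass_eq_zero_iff_dTwo _ _).1 hez0
  let eC' : C(MuCarrier F 2, T) := ⟨e.symm, continuous_of_discreteTopology⟩
  refine (threeCocycleClass_eq_zero_iff_dTwo _ _).2 ⟨eC'.comp b, fun σ τ υ => ?_⟩
  have hb' : e (z.1 (σ, τ, υ)) = dTwo (mu F 2).toTopRep b σ τ υ := hb σ τ υ
  apply e.injective
  rw [hb', dTwo_apply, dTwo_apply]
  change mu F 2 σ (b (τ, υ)) - b (σ * τ, υ) + b (σ, τ * υ) - b (σ, τ) =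
    e (σT σ (e.symm (b (τ, υ))) - e.symm (b (σ * τ, υ)) + e.symm (b (σ, τ * υ)) - e.symm (b (σ, τ)))
  rw [hmu, htriv, map_sub, map_add, map_sub, e.apply_symm_apply, e.apply_symm_apply, e.apply_symm_apply,
    e.apply_symm_apply]

end OrderTwo

/-! ## §3 The named fact from the Brauer-group statements -/

section Final

/-- **Milne I Thm. 4.10 (c), `r = 3`, injectivity — `poitouTate_three_realPlaces_injective K` for every number field `K` — from
class field theory of `𝔾_m` and Cor. 4.16**: (hH3) `H³(F, F̄ˣ)` has no `2`-torsion, for every number field `F`; (hBr) a class of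
`H²(F, F̄ˣ) = Br(F)` which is twice a class at every real place is twice a class, for every `F`; (h416) Milne I Cor. 4.16 for
every `F`.  (`= poitouTate_three_realPlaces_injective_of_base` + `realThree_injective_orderTwo_of_brauer`.)
[cite: MilneADT2006, Ch. I, Thm. 4.10 (c) and Cor. 4.16] [cite: CasselsFrohlichANT1967, Ch. VII §11] -/
theorem poitouTate_three_realPlaces_injective_of_brauer (K : Type) [Field K] [NumberField K]
    (hH3 : ∀ (F : Type) [Field F] [NumberField F] (z : galoisCohomology (units F) 3), z + z = 0 → z = 0)
    (hBr : ∀ (F : Type) [Field F] [NumberField F] (u : galoisCohomology (units F) 2),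
      (∀ w : InfinitePlace F, w.IsReal → ∃ u' : galoisCohomology ((units F).toLocal (Sum.inl w)) 2,
        galoisCohomology.localization (units F) (Sum.inl w) 2 u = u' + u') →
      ∃ u'' : galoisCohomology (units F) 2, u = u'' + u'')
    (h416 : ∀ (F : Type) [Field F] [NumberField F], poitouTate_two_realPlaces_surjective F) :
    poitouTate_three_realPlaces_injective K :=
  poitouTate_three_realPlaces_injective_of_base K
    (fun F _ _ T _ _ _ _ σ htriv hcard => realThree_injective_orderTwo_of_brauer F (hH3 F) (hBr F) T σ htriv hcard) h416

end Final

end Literature.NumberTheory.GaloisCohomology.PoitouTateFinite.SignedEC.ShaThree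

end Part6

/-!
## Part 7 — port of `Summits/BirchSwinnertonDyer/BirchSwinnertonDyer/Theorems/ThetaPartnerAtTwoSignedControlAtTwoShaThreeBaseBrauerDivisible.lean` (5 declarations kept)

# A Brauer class of a number field with trivial real localisations is twice a Brauer class — the input (hBr) of `ShaThree.realThree_injective_orderTwo_of_brauer` (K4 `SignedControlAtTwo`, stub 3 `stub_realThreeOrderTwoBase`)

Declarations of this Part (verbatim port; each keeps its own docstring and citation): `exists_eq_two_pow_smul_of_two_torsion_of_forall_isReal`, `hreal_zsmul`, `exists_eq_add_self_of_two_pow_zsmul_eq_zero`, `realBrauer_two_divisible`, `poitouTate_three_realPlaces_injective_of_H3`.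

Reference keys (see `references.bib` and the declarations' citations): [SerreLocalFields1979], [CasselsFrohlichANT1967], [MilneADT2006].
-/

section Part7

set_option autoImplicit false
open _root_.CategoryTheory _root_.NumberField _root_.Field _root_.Function _root_.IsDedekindDomain
open _root_.TopRep _root_.ContRepresentation _root_.ContinuousCohomology
open Literature.NumberTheory.GaloisRepresentations
open Literature.NumberTheory.GaloisRepresentations.DiscreteGaloisModule (mu MuCarrier units UnitsCarrier)
open Literature.NumberTheory.GaloisCohomology
open Literature.NumberTheory.EllipticCurves
open scoped _root_.NumberField

namespace Literature.NumberTheory.GaloisCohomology.PoitouTateFinite.SignedEC.ShaThreeBrauer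

variable (F : Type) [Field F] [NumberField F]

/-! ## §1 Real-trivial `2`-torsion Brauer classes are cyclic classes of the `ℤ₂`-tower, hence `2^j`-divisible -/

section TwoTorsion

/-- **A `2`-torsion Brauer class with `loc_w u ∈ 2 · H²(Γ_{F_w}, F̄ˣ|)` at every real place `w` is `2^j`-divisible for every
`j`.**  Kummer lift to `H²(Γ_F, μ₂)`; real vanishing + finite support; killing on a layer `Γ_{F_M}` of the cyclotomic
`ℤ₂`-extension; `u` is then the cyclic class `κ_{ψ_M}(b)` of the layer character `ψ_M = κ mod 2^M`, and
`κ_{ψ_M}(b) = 2^j • κ_{ψ_{M+j}}(b)`. [cite: CasselsFrohlichANT1967, Ch. VII §10] [cite: SerreLocalFields1979, XIV §1] -/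
theorem exists_eq_two_pow_smul_of_two_torsion_of_forall_isReal (u : galoisCohomology (units F) 2) (h2 : (2 : ℤ) • u = 0)
    (hreal : ∀ w : InfinitePlace F, w.IsReal → ∃ u' : galoisCohomology ((units F).toLocal (Sum.inl w)) 2,
      galoisCohomology.localization (units F) (Sum.inl w) 2 u = u' + u')
    (j : ℕ) : ∃ x : galoisCohomology (units F) 2, u = 2 ^ j • x := by
  classical
  haveI : CompactSpace (absoluteGaloisGroup F) := absoluteGaloisGroup_compactSpace F
  haveI : Fact (Nat.Prime 2) := ⟨Nat.prime_two⟩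
  -- Kummer preimage at level `2`
  obtain ⟨c, hc⟩ := exists_kummer_eq_of_nsmul_eq_zero F 2 u (by rwa [Nat.cast_ofNat])
  have hc' : (cohomologyMap (kummerι F 2) 2).hom c = u := hc
  -- finite support and real vanishing of `c`
  obtain ⟨S, hS⟩ := exists_finset_forall_localization_inr_eq_zero F c
  have hreal_c : ∀ w : InfinitePlace F, w.IsReal →
      galoisCohomology.localization (mu F 2) (Sum.inl w) 2 c = 0 := fun w hw =>
    localization_inl_eq_zero_of_localization_kummer_eq_add_self w c (by rw [hc']; exact hreal w hw)
  -- the cyclotomic `ℤ₂`-extension and the killing layer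
  obtain ⟨κ, hκ⟩ := ZpExtension.exists_isCyclotomic_holds F 2 (GaloisRep.cyclotomicCharacter_range_infinite F 2)
  obtain ⟨m₀, hm₀⟩ := exists_resH_comap_span_pow_kummer_eq_zero_of_forall_isReal F κ.toContinuousMonoidHom
    (exists_apply_resGal_ne_one_of_isCyclotomic' F 2 hκ) (show (2 : ℕ) ∣ 2 ^ 1 by norm_num) c S hS hreal_c
  have hm₀' : resH (κ.layerSubgroup m₀) (units F) 2 ((cohomologyMap (kummerι F 2) 2).hom c) = 0 := hm₀
  -- level `M = m₀ + 1` (so that `1 < 2^M`)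
  set M : ℕ := m₀ + 1 with hM
  have hVle : κ.layerSubgroup M ≤ κ.layerSubgroup m₀ := κ.layerSubgroup_antitone (Nat.le_succ m₀)
  have hkill : resH (κ.layerSubgroup M) (units F) 2 u = 0 := by
    rw [← hc', resH_eq_resSub_resH (units F) hVle 2, hm₀', map_zero]
  -- the layer character `ψ_M` and the cyclic form of `u`
  obtain ⟨ψ, hkerV, hkerL, hψ⟩ := κ.exists_cyclicCharacter_layer M
  haveI : FiniteDimensional F (κ.layer M) := κ.finiteDimensional_layer_holds M
  haveI : Fact (1 < 2 ^ M) := ⟨Nat.one_lt_two_pow (Nat.succ_ne_zero m₀)⟩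
  have hT : Subsingleton (continuousCohomology 1
      (((units F).restrict (Literature.NumberTheory.GaloisRepresentations.subgroupIncl ψ.ker)).toTopRep)) := by
    rw [hkerL]; exact subsingleton_one_units_galFixing _
  have hres : resH ψ.ker (units F) 2 u = 0 := by rw [hkerV]; exact hkill
  obtain ⟨b, hb⟩ := exists_cyclicClass_eq_of_res_eq_zero ψ (units F) hT u hres
  -- the character of level `M + j` and the change of level
  obtain ⟨ψ', -, -, hψ'⟩ := κ.exists_cyclicCharacter_layer (M + j)
  have hdvd : 2 ^ M ∣ 2 ^ (M + j) := pow_dvd_pow 2 (Nat.le_add_right M j)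
  have hcompat : ∀ σ, ψ σ = ZMod.castHom hdvd (ZMod (2 ^ M)) (ψ' σ) := fun σ => by
    rw [hψ, hψ', ← PadicInt.zmod_cast_comp_toZModPow M (M + j) (Nat.le_add_right M j)]
    rfl
  exact ⟨cyclicClass ψ' (units F) b,
    hb ▸ CyclicCharacter.cyclicClass_eq_smul_cyclicClass_of_mul ψ ψ' hdvd hcompat (units F) (pow_add 2 M j) b⟩

end TwoTorsion

/-! ## §2 Induction on the `2`-exponent -/

section Induction

/-- The real hypothesis «`loc_w u` is twice a class» is inherited by integer multiples. [folklore] -/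
private theorem hreal_zsmul (u : galoisCohomology (units F) 2) (n : ℤ)
    (hreal : ∀ w : InfinitePlace F, w.IsReal → ∃ u' : galoisCohomology ((units F).toLocal (Sum.inl w)) 2,
      galoisCohomology.localization (units F) (Sum.inl w) 2 u = u' + u') :
    ∀ w : InfinitePlace F, w.IsReal → ∃ u' : galoisCohomology ((units F).toLocal (Sum.inl w)) 2,
      galoisCohomology.localization (units F) (Sum.inl w) 2 (n • u) = u' + u' := fun w hw => by
  obtain ⟨u', hu'⟩ := hreal w hw
  exact ⟨n • u', by rw [map_zsmul, hu', smul_add]⟩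

/-- **`2^k · u = 0` and `loc_w u ∈ 2 · H²` at every real `w` ⟹ `u` is twice a Brauer class**, by induction on `k`:
`u₁ = 2^k u` is `2`-torsion, so `u₁ = 2^{k+1} x` (§1), and `u - 2x` is killed by `2^k`.
[cite: CasselsFrohlichANT1967, Ch. VII §10] [cite: SerreLocalFields1979, XIV §1] -/
theorem exists_eq_add_self_of_two_pow_zsmul_eq_zero :
    ∀ (k : ℕ) (u : galoisCohomology (units F) 2), (2 ^ k : ℤ) • u = 0 →
      (∀ w : InfinitePlace F, w.IsReal → ∃ u' : galoisCohomology ((units F).toLocal (Sum.inl w)) 2,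
        galoisCohomology.localization (units F) (Sum.inl w) 2 u = u' + u') →
      ∃ x : galoisCohomology (units F) 2, u = x + x
  | 0, u, h, _ => ⟨0, by rw [pow_zero, one_smul] at h; rw [h, add_zero]⟩
  | k + 1, u, h, hreal => by
    -- `u₁ = 2^k u` is `2`-torsion with the real property
    have h1 : (2 : ℤ) • ((2 ^ k : ℤ) • u) = 0 := by
      rw [smul_smul, show (2 : ℤ) * 2 ^ k = 2 ^ (k + 1) by ring, h]
    obtain ⟨x, hx⟩ := exists_eq_two_pow_smul_of_two_torsion_of_forall_isReal F ((2 ^ k : ℤ) • u) h1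
      (hreal_zsmul F u _ hreal) (k + 1)
    -- `u₂ = u - (x + x)` is killed by `2^k`
    have hx' : (2 ^ k : ℤ) • u = (2 ^ k : ℤ) • (x + x) := by
      rw [hx, smul_add, ← add_smul, ← natCast_zsmul]
      congr 1
      push_cast
      ring
    have h2 : (2 ^ k : ℤ) • (u - (x + x)) = 0 := by rw [smul_sub, hx', sub_self]
    have hreal2 : ∀ w : InfinitePlace F, w.IsReal → ∃ u' : galoisCohomology ((units F).toLocal (Sum.inl w)) 2,
        galoisCohomology.localization (units F) (Sum.inl w) 2 (u - (x + x)) = u' + u' := fun w hw => by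
      obtain ⟨u', hu'⟩ := hreal w hw
      refine ⟨u' - galoisCohomology.localization (units F) (Sum.inl w) 2 x, ?_⟩
      rw [map_sub, hu', map_add]
      abel
    obtain ⟨y, hy⟩ := exists_eq_add_self_of_two_pow_zsmul_eq_zero k (u - (x + x)) h2 hreal2
    refine ⟨x + y, ?_⟩
    rw [← sub_add_cancel u (x + x), hy]
    abel

end Induction

/-! ## §3 (hBr): a Brauer class with trivial real localisations is twice a class -/

section Main

/-- **(hBr) for every number field `F`: a class of `Br(F) = H²(Γ_F, F̄ˣ)` whose localisation at every real place `w` is twice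
a class of `H²(Γ_{F_w}, F̄ˣ|)` (equivalently vanishes, `2 · H²(Γ_{F_w}, ·) = 0`) is twice a class of `Br(F)`** — the injectivity
half of `Br(F)/2 ≅ ⊕_{w real} Br(F_w)`.  `Br(F)` is torsion; the odd part of a class is `2`-divisible for free; the `2`-primary
part by §2. This is EXACTLY the hypothesis (hBr) of `ShaThree.realThree_injective_orderTwo_of_brauer`.
[cite: CasselsFrohlichANT1967, Ch. VII §10–§11] [cite: MilneADT2006, Ch. I, Thm. 4.10 (c)] -/
theorem realBrauer_two_divisible (u : galoisCohomology (units F) 2)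
    (hreal : ∀ w : InfinitePlace F, w.IsReal → ∃ u' : galoisCohomology ((units F).toLocal (Sum.inl w)) 2,
      galoisCohomology.localization (units F) (Sum.inl w) 2 u = u' + u') :
    ∃ u'' : galoisCohomology (units F) 2, u = u'' + u'' := by
  classical
  -- torsion: `N • u = 0`, `N = 2^k m`, `m` odd
  obtain ⟨N, hN, hNu⟩ := exists_pos_natCast_zsmul_eq_zero F u
  obtain ⟨k, m, hm2, hNkm⟩ := Nat.exists_eq_pow_mul_and_not_dvd hN.ne' 2 (by norm_num)
  have hm0 : m ≠ 0 := by rintro rfl; rw [mul_zero] at hNkm; exact hN.ne' hNkm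
  -- Bézout
  have hcop : Nat.Coprime (2 ^ k) m := (Nat.Prime.coprime_iff_not_dvd Nat.prime_two).2 hm2 |>.pow_left k
  obtain ⟨s, t, hst⟩ : ∃ s t : ℤ, s * (2 ^ k : ℕ) + t * m = 1 := Nat.isCoprime_iff_coprime.2 hcop
  -- the part killed by `m` (odd): `a = 2^k u`
  set a : galoisCohomology (units F) 2 := ((2 ^ k : ℕ) : ℤ) • u with ha_def
  have ha : (m : ℤ) • a = 0 := by
    rw [ha_def, smul_smul, ← Nat.cast_mul, mul_comm, ← hNkm]; exact hNu
  have hodd : Odd m := Nat.odd_iff.2 (Nat.two_dvd_ne_zero.1 hm2)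
  obtain ⟨r, hr⟩ := hodd.add_one
  have ha2 : a = (r : ℤ) • a + (r : ℤ) • a := by
    have e : ((m + 1 : ℕ) : ℤ) • a = a := by rw [Nat.cast_succ, add_smul, ha, zero_add, one_smul]
    rw [← add_smul, ← Nat.cast_add, ← hr, e]
  -- the part killed by `2^k`: `b = m u`, twice a class by §2
  set b : galoisCohomology (units F) 2 := (m : ℤ) • u with hb_def
  have hb : (2 ^ k : ℤ) • b = 0 := by
    rw [hb_def, smul_smul, show (2 : ℤ) ^ k * (m : ℤ) = (N : ℤ) by rw [hNkm]; push_cast; ring]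
    exact hNu
  obtain ⟨y, hy⟩ := exists_eq_add_self_of_two_pow_zsmul_eq_zero F k b hb (hreal_zsmul F u _ hreal)
  -- `u = s • a + t • b`
  have hu : u = s • a + t • b := by
    rw [ha_def, hb_def, smul_smul, smul_smul, ← add_smul, hst, one_smul]
  refine ⟨s • ((r : ℤ) • a) + t • y, ?_⟩
  rw [hu, hy, smul_add]
  conv_lhs => rw [ha2, smul_add]
  abel

end Main

/-! ## §4 The stub from (hH3) alone -/

section Consequences

/-- **Milne I Thm. 4.10 (c), `r = 3` — `poitouTate_three_realPlaces_injective K` for every number field `K` — from the single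
remaining statement (hH3) `H³(F, F̄ˣ)[2] = 0` for every number field `F`** (B7 `poitouTate_three_realPlaces_injective_of_brauer` with
(hBr) = `realBrauer_two_divisible` and Cor. 4.16 = `poitouTate_two_realPlaces_surjective_holds`).
[cite: MilneADT2006, Ch. I, Thm. 4.10 (c) and Cor. 4.16] [cite: CasselsFrohlichANT1967, Ch. VII §11] -/
theorem poitouTate_three_realPlaces_injective_of_H3 (K : Type) [Field K] [NumberField K]
    (hH3 : ∀ (F : Type) [Field F] [NumberField F] (z : galoisCohomology (units F) 3), z + z = 0 → z = 0) :
    poitouTate_three_realPlaces_injective K :=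
  ShaThree.poitouTate_three_realPlaces_injective_of_brauer K hH3 (fun F _ _ => realBrauer_two_divisible F)
    (fun F _ _ => poitouTate_two_realPlaces_surjective_holds F)

end Consequences

end Literature.NumberTheory.GaloisCohomology.PoitouTateFinite.SignedEC.ShaThreeBrauer

end Part7

/-!
## Part 8 — port of `Summits/BirchSwinnertonDyer/BirchSwinnertonDyer/Theorems/ThetaPartnerAtTwoSignedControlAtTwoShaThreeBaseH3Units.lean` (8 declarations kept)

# `H³(F, F̄ˣ) = 0` for a number field (Tate), hence (hH3), hence `stub_realThreeOrderTwoBase` and Milne I 4.10 (c)₃ (K4 `SignedControlAtTwo`, , line `eulerchar`, stub 3)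

Declarations of this Part (verbatim port; each keeps its own docstring and citation): `ext_three_ideleBarD_eq_zero`, `exists_nsmul_eq_zero'`, `inflLayer_ideleData_comp_limitHom`, `exists_ext_two_ideleBarD_comp_eq`, `ext_three_unitsBarD_eq_zero`, `galoisCohomology_units_three_eq_zero`, `units_three_two_torsion_eq_zero`, `poitouTate_three_realPlaces_injective_holds`.

Reference keys (see `references.bib` and the declarations' citations): [CasselsFrohlichANT1967], [Harari2020], [MilneADT2006].
-/

section Part8

set_option autoImplicit false
open _root_.CategoryTheory CategoryTheory.Abelian _root_.NumberField _root_.Field _root_.Function groupCohomology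
open Literature.NumberTheory.GaloisRepresentations
open Literature.NumberTheory.GaloisRepresentations.IdeleClassBar
open Literature.NumberTheory.GaloisRepresentations.DiscreteGaloisModule (units)
open Literature.NumberTheory.GaloisCohomology
open Literature.NumberTheory.NumberFields
open Literature.NumberTheory.Automorphic
open Literature.AnabelianGeometry.AbsoluteAnabelian.Prop121vii
open Literature.Algebra.Homology Literature.Algebra.Homology.DiscreteRep
open scoped _root_.Classical

namespace Literature.NumberTheory.GaloisCohomology.PoitouTateFinite.SignedEC.ShaThreeBrauer

variable (F : Type) [Field F] [NumberField F]

/-! ## §1 `Ext³_{C_Γ}(ℤ, J̄) = 0` -/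

section IdeleThree

/-- **`Ext³_{C_Γ}(ℤ, J̄) = 0`**: every class of the limit is inflated from some `H³(Gal(E/F), J_E)`, and these vanish
(Harari Cor. 13.2: `H³(G, I_K) = 0`; door-c5 `isZero_H3_ideleRep`). [cite: Harari2020, Corollary 13.2]
[cite: CasselsFrohlichANT1967, Ch. VII §7.3 Cor. 7.4] -/
theorem ext_three_ideleBarD_eq_zero [CompactSpace (absoluteGaloisGroup F)] [TotallyDisconnectedSpace (absoluteGaloisGroup F)]
    (y : Ext (triv (k := ℤ) (Γ := absoluteGaloisGroup F) ℤ) (ideleBarD F) 3) : y = 0 := by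
  obtain ⟨E, c, rfl⟩ := (ideleData F).exists_inflLayer_eq 3 y
  haveI := E.numberField
  haveI := E.isGalois
  haveI : Subsingleton (groupCohomology ((ideleData F).obj E) 3) := by
    rw [ideleData_obj]
    exact ModuleCat.subsingleton_of_isZero (IdeleCohomology.isZero_H3_ideleRep (F := F) (E := E.1))
  rw [Subsingleton.elim c 0, map_zero]

end IdeleThree

/-! ## §2 `Ext²(ℤ, J̄) → Ext²(ℤ, C̄)` is onto -/

section IdeleToClassTwo

/-- Every `t ∈ ℚ/ℤ` is killed by a positive integer. [folklore] -/
private theorem exists_nsmul_eq_zero' (t : AddCircle (1 : ℚ)) : ∃ N : ℕ, 0 < N ∧ N • t = 0 := by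
  induction t using QuotientAddGroup.induction_on with
  | H q =>
    refine ⟨q.den, q.den_pos, ?_⟩
    change q.den • ((q : ℚ) : AddCircle (1 : ℚ)) = 0
    rw [← AddCircle.coe_nsmul, nsmul_eq_mul, Rat.den_mul_eq_num, ← zsmul_one, AddCircle.coe_zsmul,
      AddCircle.coe_period, smul_zero]

/-- **The layer inflations intertwine `J̄ → C̄` with `H²(Gal(E/F), J_E → C_E)`**:
`Inf_E(x) ∘ (J̄ → C̄) = Inf_E(H²(classRepHom) x)` .
[cite: CasselsFrohlichANT1967, Ch. VII §11.1] -/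
theorem inflLayer_ideleData_comp_limitHom [CompactSpace (absoluteGaloisGroup F)] [TotallyDisconnectedSpace (absoluteGaloisGroup F)]
    (E : GalLayer F) (n : ℕ) (x : groupCohomology ((ideleData F).obj E) n) :
    ((ideleData F).inflLayer E n x).comp (Ext.mk₀ (ideleToClass F).limitHom) (add_zero n) =
      (classData F).inflLayer E n
        ((groupCohomology.functor ℤ (E.1 ≃ₐ[F] E.1) n).map
          (haveI := E.numberField; IdeleClassGroup.classRepHom F E.1) x) := by
  rw [GalLayerData.inflLayer_apply, GalLayerData.inflLayer_apply, ← LayerColimit.inflG_map]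
  congr 1
  -- `(J̄ → C̄)^{U_E}_* (iso_J⁻¹ x) = iso_C⁻¹ (H²(classRepHom) x)`
  have h := congrArg
    (fun φ : groupCohomology ((ideleData F).layerRep E) n ⟶ groupCohomology ((classData F).obj E) n =>
      φ (((ideleData F).layerCohomologyIso E n).inv x))
    (functor_map_ideleToClass_comp_layerCohomologyIso F E n)
  change ((classData F).layerCohomologyIso E n).hom
      (((groupCohomology.functor ℤ (absoluteGaloisGroup F ⧸ (E.openNormalSubgroup : Subgroup (absoluteGaloisGroup F))) n).map
        ((DiscreteRep.invariantsQuotFunctor ℤ (E.openNormalSubgroup : Subgroup (absoluteGaloisGroup F))).map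
          (ideleToClass F).limitHom))
        (((ideleData F).layerCohomologyIso E n).inv x)) =
    ((groupCohomology.functor ℤ (E.1 ≃ₐ[F] E.1) n).map (haveI := E.numberField; IdeleClassGroup.classRepHom F E.1))
      (((ideleData F).layerCohomologyIso E n).hom (((ideleData F).layerCohomologyIso E n).inv x)) at h
  rw [Iso.inv_hom_id_apply] at h
  apply ((classData F).layerCohomologyIso E n).toLinearEquiv.injective
  change ((classData F).layerCohomologyIso E n).hom _ =
    ((classData F).layerCohomologyIso E n).hom (((classData F).layerCohomologyIso E n).inv _)
  rw [Iso.inv_hom_id_apply]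
  exact h

/-- **`Ext²_{C_Γ}(ℤ, J̄) → Ext²_{C_Γ}(ℤ, C̄)` is surjective** (`H²(Γ_F, J̄) ↠ H²(Γ_F, C̄)`): `inv_F` is injective on
`Ext²(ℤ, C̄)`, and every `t ∈ ℚ/ℤ` is `inv_F` of the image of an idèle class — at a CYCLIC layer `E/F` of degree divisible by the
order of `t` the class map `H²(J_E) → H²(C_E)` is onto and `inv_{E/F}` takes every value of `(1/[E:F])ℤ/ℤ`.
[cite: CasselsFrohlichANT1967, Ch. VII §11.2 (bis)] [cite: Harari2020, Theorem 13.23] -/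
theorem exists_ext_two_ideleBarD_comp_eq [CompactSpace (absoluteGaloisGroup F)] [TotallyDisconnectedSpace (absoluteGaloisGroup F)]
    (c : Ext (triv (k := ℤ) (Γ := absoluteGaloisGroup F) ℤ) (ideleClassLimitShortComplex F).X₃ 2) :
    ∃ j : Ext (triv (k := ℤ) (Γ := absoluteGaloisGroup F) ℤ) (ideleClassLimitShortComplex F).X₂ 2,
      j.comp (Ext.mk₀ (ideleClassLimitShortComplex F).g) (add_zero 2) = c := by
  change ∃ j : Ext (triv (k := ℤ) (Γ := absoluteGaloisGroup F) ℤ) (ideleBarD F) 2,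
    j.comp (Ext.mk₀ (ideleToClass F).limitHom) (add_zero 2) = c
  -- the order of `inv_F c`
  obtain ⟨N, hN, hNt⟩ := exists_nsmul_eq_zero' (classBarInvD F c)
  -- a cyclic layer of degree divisible by `N`
  obtain ⟨L, hfin, hgal, hcyc, hdvd⟩ := exists_isCyclic_dvd_finrank (F := F) hN.ne'
  haveI := hfin
  haveI := hgal
  let E : GalLayer F := ⟨L, hfin, hgal⟩
  haveI := E.numberField
  haveI : IsGalois F E.1 := hgal
  haveI : IsCyclic (E.1 ≃ₐ[F] E.1) := hcyc
  haveI : NeZero (Module.finrank F E.1) := ⟨Module.finrank_pos.ne'⟩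
  -- `inv_F c` is a value of `inv_{E/F}`
  have hnt : Module.finrank F E.1 • classBarInvD F c = 0 := by
    obtain ⟨k, hk⟩ := hdvd
    change Module.finrank F L • classBarInvD F c = 0
    rw [hk, mul_comm, ← smul_smul, hNt, smul_zero]
  obtain ⟨a, ha⟩ := UnitsLayer.mem_range_zmodToQmodZ_of_nsmul_eq_zero (Module.finrank F E.1) (classBarInvD F c) hnt
  have hmem : zmodToQmodZ (Module.finrank F E.1) a ∈ Set.range (IdeleCohomology.classInvAll F E.1) := by
    rw [IdeleCohomology.range_classInvAll]
    exact ⟨a, rfl⟩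
  obtain ⟨y, hy⟩ := hmem
  -- `y` is the image of an idèle class (cyclic layer)
  obtain ⟨jE, hjE⟩ := IdeleCohomology.ideleToClass_surjective_of_isCyclic (F := F) (E := E.1) y
  refine ⟨(ideleData F).inflLayer E 2 jE, classBarInvD_injective F ?_⟩
  -- `inv_F` of an inflated layer class is the layer invariant
  have key : ∀ y' : groupCohomology ((classData F).obj E) 2,
      classBarInvD F ((classData F).inflLayer E 2 y') = IdeleCohomology.classInvAll F E.1 y' := fun y' => by
    rw [GalLayerData.inflLayer_apply]
    exact (LayerColimit.desc_inflG (isCompatibleFamily_layerInvD F) E _).trans (layerInvD_iso_inv F E y')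
  have hmap : (groupCohomology.functor ℤ (E.1 ≃ₐ[F] E.1) 2).map (IdeleClassGroup.classRepHom F E.1) jE =
      IdeleCohomology.ideleToClass F E.1 jE := by
    rw [groupCohomology.functor_map, IdeleCohomology.ideleToClass_apply]
    rfl
  rw [inflLayer_ideleData_comp_limitHom, key]
  refine (congrArg (IdeleCohomology.classInvAll F E.1) hmap).trans ?_
  rw [hjE, hy, ha]

end IdeleToClassTwo

/-! ## §3 `H³(Γ_F, F̄ˣ) = 0` -/

section UnitsThree

/-- **`Ext³_{C_Γ}(ℤ, lim→ Eˣ) = 0`**: in the covariant `Ext` sequence of `0 → lim→ Eˣ → J̄ → C̄ → 0`,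
`Ext²(J̄) ↠ Ext²(C̄) → Ext³(lim Eˣ) → Ext³(J̄) = 0`. [cite: CasselsFrohlichANT1967, Ch. VII §11.4] [cite: Harari2020, Corollary 13.2] -/
theorem ext_three_unitsBarD_eq_zero [CompactSpace (absoluteGaloisGroup F)] [TotallyDisconnectedSpace (absoluteGaloisGroup F)]
    (e : Ext (triv (k := ℤ) (Γ := absoluteGaloisGroup F) ℤ) (unitsBarD F) 3) : e = 0 := by
  have hS := ideleClassLimitShortComplex_shortExact F
  have h1 : e.comp (Ext.mk₀ (ideleClassLimitShortComplex F).f) (add_zero 3) = 0 :=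
    ext_three_ideleBarD_eq_zero F _
  obtain ⟨c, hc⟩ := Ext.covariant_sequence_exact₁ (triv (k := ℤ) (Γ := absoluteGaloisGroup F) ℤ) hS e h1 (n₀ := 2) rfl
  obtain ⟨j, hj⟩ := exists_ext_two_ideleBarD_comp_eq F c
  rw [← hc, ← hj, Ext.comp_assoc_of_second_deg_zero, hS.comp_extClass, Ext.comp_zero]
  rfl

/-- **`H³(Γ_F, F̄ˣ) = 0` for every number field `F`** (Tate), in the tree's cochain Galois cohomology `galoisCohomology (units F) 3`:
transport of `ext_three_unitsBarD_eq_zero` along `unitsBarIso : lim→ Eˣ ≅ F̄ˣ` and `Ext³_{C_Γ}(ℤ, F̄ˣ) ≃ H³(Γ_F, F̄ˣ)`.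
[cite: CasselsFrohlichANT1967, Ch. VII §11.4] [cite: Harari2020, Corollary 13.2] -/
theorem galoisCohomology_units_three_eq_zero (z : galoisCohomology (units F) 3) : z = 0 := by
  haveI : CompactSpace (absoluteGaloisGroup F) := absoluteGaloisGroup_compactSpace F
  set e := (extTrivAddEquivGaloisCohomology (units F) 3).symm z with he
  have hz : z = extTrivAddEquivGaloisCohomology (units F) 3 e := by rw [he, AddEquiv.apply_symm_apply]
  -- move `e` to `Ext³(ℤ, unitsBarD F)` and back
  have h0 : e.comp (Ext.mk₀ (unitsBarIso F).inv) (add_zero 3) = 0 := ext_three_unitsBarD_eq_zero F _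
  have he0 : e = 0 := by
    have h1 : (e.comp (Ext.mk₀ (unitsBarIso F).inv) (add_zero 3)).comp (Ext.mk₀ (unitsBarIso F).hom) (add_zero 3) = e := by
      rw [Ext.comp_assoc_of_second_deg_zero, Ext.mk₀_comp_mk₀, Iso.inv_hom_id, Ext.comp_mk₀_id]
    rw [← h1, h0, Ext.zero_comp]
  rw [hz, he0, map_zero]

end UnitsThree

/-! ## §4 (hH3), the stub, and Milne I 4.10 (c)₃ -/

section Consequences

/-- **(hH3) `H³(F, F̄ˣ)[2] = 0`** — the hypothesis of B7 `ShaThree.realThree_injective_orderTwo_of_brauer`, trivially from §3.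
[cite: CasselsFrohlichANT1967, Ch. VII §11.4] -/
theorem units_three_two_torsion_eq_zero (z : galoisCohomology (units F) 3) (_h : z + z = 0) : z = 0 :=
  galoisCohomology_units_three_eq_zero F z

/-- **Milne I Thm. 4.10 (c), `r = 3`: `poitouTate_three_realPlaces_injective K` HOLDS for every number field `K`**
(`poitouTate_three_realPlaces_injective_of_H3` with (hH3) discharged). [cite: MilneADT2006, Ch. I, Thm. 4.10 (c)] -/
theorem _root_.Literature.NumberTheory.GaloisCohomology.poitouTate_three_realPlaces_injective_holds :
    ∀ (K : Type) [Field K] [NumberField K], poitouTate_three_realPlaces_injective K :=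
  fun K _ _ => poitouTate_three_realPlaces_injective_of_H3 K fun F _ _ => units_three_two_torsion_eq_zero F

end Consequences

end Literature.NumberTheory.GaloisCohomology.PoitouTateFinite.SignedEC.ShaThreeBrauer

end Part8

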